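import Literature.Probability.FitznerVanDerHofstad2017.Stage1CellsRec

/-!
# Literature.Probability.FitznerVanDerHofstad2017.Stage1CellsRem — the RECORD stage-1 recipe with the ten remainder reads as SLOTS (N68g part (g2))

CITATION HEADER (PLACEMENT v2). Part of the certified REPRODUCTION of R. Fitzner, R. van der Hofstad, *Mean-field
behavior for nearest-neighbor percolation in d > 10*, EJP 22 (2017) no. 43 [FvdH17] (notebook `Percolation.nb`) and
*Generalized approach to the non-backtracking lace expansion*, PTRF 169 (2017) 1041–1119 [NoBLE17]; build `lace`, seat
lean2 (gen 12); LEMMAS §20 node N68g = the ORACLE RE-CUT admitted by REFEREE v41 R228, part (g2) of carver-g16's typed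
spec (LEMMAS §20 addendum 3 (A)): the TYPED RECIPE with abstract remainder constants.  ADDITIVE companion of
`Stage1Cells.lean` / `Stage1CellsRec.lean` (nothing there is changed; the binders of record `NobleImprovementInputsAt` /
`NobleInitialInputsAt` are not touched); no numeral of the notebooks, no table, no verdict; nothing here is a cited fact —
pure `PX` syntax like `Stage1Cells`.

WHAT.  In the record recipe (`Stage1Cells` = `Percolation.nb` AS CODED, with the weighted bubble OF RECORD
`Stage1Cells.Rec`, D46/D34) the trail REMAINDER of every extracted chain enters ONLY as a table atom — the ten "hooked
reads" per bootstrap point of HOME/DIVERGENCE.md D55: row 1 = cell 5 `Bound[G,{1},m,s]` tail `Ivalue[1,R′,{0}]`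
(`Stage1Cells.G1`), row 2 = cell 8 `Bound[G,{0,1},m,s]` tail `Ivalue[1,R′,{0}]` (`G01`), rows 3–6 = cell 11
`Bound[Bubble|Triangle|Square,m,s]` remainder terms `Ivalue[n,R′,{0}]`, `n = 1..4` (`bubble`, `triangle`, `square`),
rows 7–10 = cell 12 `Bound[OpenBubble|OpenTriangle|OpenSquare,m,s]` remainder terms `K[n,CS+1,{1}]`, `n = 1..4`
(`openBubble`, `openTriangle`, `openSquare`).  This file re-binds, in the nested namespace `Stage1Cells.Rem` and under the
SAME NAMES, these eight head cells with the ten atoms replaced by SLOT TERMS `ρ : Fin 10 → T` (slot `r` = D55 row `r+1`;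
same key, different slot for rows 1/2/3 because the N53 substitute differs by cell: `e₁` kernel at `M = R′−1` in cell 5,
uniform kernel at `M = R′` in cells 8/11), and then EVERY cell of the record recipe that depends on them (135 definitions
in all, text copied mechanically from `Stage1Cells.lean` sha256 5e6ef7a931fe3683… and `Stage1CellsRec.lean` sha256 b27bcc23395e43b9…,
generator `lean2/g12/g2/gen_cells_rem.py`; each copy takes the extra argument `ρ` right after `P`).  NOT hooked, exactly
as D55 records: cell 6's `Ivalue[1,R′+2,{0}]` / `Ivalue[1,MS,{0}]`, the first arguments `(2dz)^{m−k}·VarGamma2ⁿ·K[n,m,{1}]`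
of the `Min`'s of cell 12, cell 9's `K[1,maxpossible,{1}]`, every walk-count read, the weighted bubble's own K-tails
(`Rec.wbIn`), all multiplicities and the `z[s]`, `VarGamma2[s]` factors.

UNITS.  A slot carries the value in TABLE units: the recipe multiplies slot `r` by the same `(2d z)^{…}·VarGamma2[s]^{…}`
factors as the atom it replaces, so a remainder-kernel constant `R_r` in the RAW-count normalisation of
`NbwRemainderFrame.lean` (`trailRem ≤ Γ̄₂ⁿ·R`) corresponds to the slot value `R_r/(2d)^{M_r}` with `M_r = R′−1` (row 1),
`R′` (rows 2–6), `CS+1` (rows 7–10) (D55 NORMALISATION; `R′ = Params.R = Explicit + 2`).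

REPRODUCTION (R228 (2), literal half).  `printSlots P` values the ten slots at the record's own atoms; for every re-bound
cell `X` the theorem `Rem.X_print : Rem.X P (printSlots P) … = X P …` holds by `rfl` (`X` = `Stage1Cells.X`, or
`Stage1Cells.Rec.X` for the cells of record) — the re-cut recipe at the record reads IS the record recipe, definitionally;
hence its Stage-1 evaluation at the record reads is the evaluation of record (`Stage1EvalRec`, `MeanFieldD11Stage1EvalRec`)
with nothing to re-validate.  The frame over the slotted recipe (`Data.inpRem ρ`, the derived atoms `mubOverMu`,
`1/(1 − Bound[OpenBubble,1,s])` recomputed from `Rem.G13 ρ` / `Rem.openBubble ρ`) and its rational mirror for a table of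
certified NBW caps follow the `Stage1EvalRec` pattern in the instantiating module; the validity predicate on the ten
constants and the re-cut oracle `NobleImprovementInputsRemAt` live in `NobleImprovementInputsRem.lean`.

[cite: FitznerVanDerHofstad2017, notebook Percolation.nb cells 5, 8, 11, 12 (transcript l.237–241, 303–310, 389–404, 419–429)]
[cite: FitznerVanDerHofstad2016NoBLE, (5.23)–(5.27) and §5.3.2 (first display) p. 1097]
-/

namespace Literature.Probability.FitznerVanDerHofstad2017
namespace Stage1Cells

open NoGoFrame (Pt)
open PX

namespace Rem

section Cells

variable (P : Params) (ρ : Fin 10 → T)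

/-! ## Cells 5–10: two-point function bounds -/
/-- (re-cut copy of `Stage1Cells.G1`, remainder reads as slots `ρ`) Cell 5: `Bound[G,{1},m,s] = Σ_{j=m}^{Explicit} z^j nrSAW[j,d,{1}] + (2dz)^{RSteps−1} VarGamma2 Ivalue[1,RSteps,{0}]`.
[cite: FitznerVanDerHofstad2017, notebook Percolation.nb cell 5 (transcript l.237–241)] -/
def G1 (m : ℕ) : T :=
  sumR m P.E (fun j => z ^ j * tab (.saw j .v1)) + w P ^ (P.R - 1) * Vg * ρ 0
/-- (re-cut copy of `Stage1Cells.G01`, remainder reads as slots `ρ`) Cell 8 from the lower index `n` on: `Σ_{j=n}^{Explicit} z^j nrSAW[j,d,{0,1}] + (2dz)^{RSteps} VarGamma2 Ivalue[1,RSteps,{0}]`.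
[cite: FitznerVanDerHofstad2017, notebook Percolation.nb cell 8 (transcript l.303–310)] -/
def G01 (n : ℕ) : T :=
  sumR n P.E (fun j => z ^ j * tab (.saw j .v01)) + w P ^ P.R * Vg * ρ 1
/-- (re-cut copy of `Stage1Cells.Gtwoi6`, remainder reads as slots `ρ`) Cell 8, reduced (M6a): `Bound[G,twoi,6,s] = Bound[G,{0,1},6,s] − 36(d−2)² z^6`. [cite: FitznerVanDerHofstad2017, notebook Percolation.nb cell 8 (transcript l.303–310)] -/
def Gtwoi6 : T := z ^ 6 * tab .sawTwoi6 + G01 P ρ 7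
/-- (re-cut copy of `Stage1Cells.Gtwoi4`, remainder reads as slots `ρ`) Cell 8: `Bound[G,twoi,4,s] = 2(d−1) z^4 + Bound[G,twoi,6,s]`. [cite: FitznerVanDerHofstad2017, notebook Percolation.nb cell 8 (transcript l.303–310)] -/
def Gtwoi4 : T := C (2 * (P.d - 1)) * z ^ 4 + Gtwoi6 P ρ
/-- (re-cut copy of `Stage1Cells.Gtwoi2`, remainder reads as slots `ρ`) Cell 8: `Bound[G,twoi,2,s] = Bound[G,twoi,4,s]`. [cite: FitznerVanDerHofstad2017, notebook Percolation.nb cell 8 (transcript l.303–310)] -/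
def Gtwoi2 : T := Gtwoi4 P ρ
/-- (re-cut copy of `Stage1Cells.Gmax1`, remainder reads as slots `ρ`) Cell 9: `Bound[G,max,1,s] = Max[Bound[G,max,2,s], Bound[G,{1},1,s]]`. [cite: FitznerVanDerHofstad2017, notebook Percolation.nb cell 9 (transcript l.334–343)] -/
def Gmax1 : T := max (GmaxT P ((P.mp - 2) / 2)) (G1 P ρ 1)
/-- (re-cut copy of `Stage1Cells.G13`, remainder reads as slots `ρ`) `Bound[G,{1},3,s]` (the argument of `mubOverMu`, cell 10).
[cite: FitznerVanDerHofstad2017, notebook Percolation.nb cell 10] -/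
abbrev G13 : T := G1 P ρ 3
/-! ## Cells 11–12: repulsive and open diagrams (with the shift `k` of device M2) -/
/-- (re-cut copy of `Stage1Cells.Loop4`, remainder reads as slots `ρ`) Cell 11: `Bound[Loop,4,s] = 2dz Bound[G,{1},3,s]`. [cite: FitznerVanDerHofstad2017, notebook Percolation.nb cell 11 (transcript l.389–404)] -/
def Loop4 : T := w P * G13 P ρ
/-- (re-cut copy of `Stage1Cells.bubble`, remainder reads as slots `ρ`) Cell 11: `Bound[Bubble,m,s]/(2dz)^k = Σ_{j=m}^{Explicit} (j+1−m) nrBAW[j,d,{0}] z^j/(2dz)^k + (RSteps−m)(2dz)^{RSteps−k}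
VarGamma2 I[1,RSteps,{0}] + (2dz)^{RSteps−k} VarGamma2² I[2,RSteps,{0}]` (`k = 0` is the cell; `k ≤ 2 ≤ m` used).
[cite: FitznerVanDerHofstad2017, notebook Percolation.nb cell 11 (transcript l.389–404)] -/
def bubble (m k : ℕ) : T :=
  sumR m P.E (fun j => C (j + 1 - m) * tab (.baw j .v0) * zsh P j k)
    + C (P.R - m) * w P ^ (P.R - k) * Vg * ρ 2
    + w P ^ (P.R - k) * Vg ^ 2 * ρ 3
/-- (re-cut copy of `Stage1Cells.triangle`, remainder reads as slots `ρ`) Cell 11: `Bound[Triangle,m,s]/(2dz)^k`. [cite: FitznerVanDerHofstad2017, notebook Percolation.nb cell 11 (transcript l.389–404)] -/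
def triangle (m k : ℕ) : T :=
  sumR m P.E (fun j => C (j + 1 - m) * C (j + 2 - m) * tab (.baw j .v0) * zsh P j k /ₙ 2)
    + C (P.R - m) * C (P.R - 1 - m) * w P ^ (P.R - k) * Vg * ρ 2 /ₙ 2
    + C (P.R + 1 - m) * w P ^ (P.R - k) * Vg ^ 2 * ρ 3
    + w P ^ (P.R - k) * Vg ^ 3 * ρ 4
/-- (re-cut copy of `Stage1Cells.square`, remainder reads as slots `ρ`) Cell 11: `Bound[Square,m,s]/(2dz)^k`. [cite: FitznerVanDerHofstad2017, notebook Percolation.nb cell 11 (transcript l.389–404)] -/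
def square (m k : ℕ) : T :=
  sumR m P.E (fun j => C (j + 1 - m) * C (j + 2 - m) * C (j + 3 - m) * tab (.baw j .v0) * zsh P j k /ₙ 6)
    + C (P.R + 1 - m) * C (P.R + 2 - m) * C (P.R + 3 - m) * w P ^ (P.R - k) * Vg * ρ 2 /ₙ 6
    + C (P.R - m) * C (P.R - 1 - m) * w P ^ (P.R - k) * Vg ^ 2 * ρ 3 /ₙ 2
    + C (P.R - m) * w P ^ (P.R - k) * Vg ^ 3 * ρ 4
    + w P ^ (P.R - k) * Vg ^ 4 * ρ 5
/-- (re-cut copy of `Stage1Cells.openBubble`, remainder reads as slots `ρ`) Cell 12: `Bound[OpenBubble,m,s]/(2dz)^k = Min[(2dz)^{m−k} VarGamma2² K[2,m,{1}], Max[Σ_{j=m}^{CS} (j+1−m) z^j nrBAW[j,d,{2}],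
Σ … nrBAW[j,d,{1}]]/(2dz)^k + (CS+1−m)(2dz)^{CS+1−k} K[1,CS+1,{1}] + (2dz)^{CS+1−k} VarGamma2² K[2,CS+1,{1}]]`
(NB: no `VarGamma2` on the `K[1,…]` term, as coded). [cite: FitznerVanDerHofstad2017, notebook Percolation.nb cell 12 (transcript l.419–429)] -/
def openBubble (m k : ℕ) : T :=
  min (w P ^ (m - k) * Vg ^ 2 * tab (.K 2 m .v1))
    (max (sumR m P.CS fun j => C (j + 1 - m) * zsh P j k * tab (.baw j .v2))
         (sumR m P.CS fun j => C (j + 1 - m) * zsh P j k * tab (.baw j .v1))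
      + C (P.CS + 1 - m) * w P ^ (P.CS + 1 - k) * ρ 6
      + w P ^ (P.CS + 1 - k) * Vg ^ 2 * ρ 7)
/-- (re-cut copy of `Stage1Cells.openTriangle`, remainder reads as slots `ρ`) Cell 12: `Bound[OpenTriangle,m,s]/(2dz)^k`, AS CODED — the `Max[…]` MULTIPLIES the first tail term (HOME/DIVERGENCE.md
D12; [FvdH17] has a sum); the shift acts on the `(2dz)^{CS+1}` factors. [cite: FitznerVanDerHofstad2017, notebook Percolation.nb cell 12 (transcript l.419–429)] -/
def openTriangle (m k : ℕ) : T :=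
  min (w P ^ (m - k) * Vg ^ 3 * tab (.K 3 m .v1))
    (max (sumR m P.CS fun j => C (j + 1 - m) * C (j + 2 - m) * z ^ j * tab (.baw j .v2) /ₙ 2)
         (sumR m P.CS fun j => C (j + 1 - m) * C (j + 2 - m) * z ^ j * tab (.baw j .v1) /ₙ 2)
        * C (P.CS + 1 - m) * C (P.CS - m) * w P ^ (P.CS + 1 - k) * Vg * ρ 6 /ₙ 2
      + C (P.CS + 1 - m) * w P ^ (P.CS + 1 - k) * Vg ^ 2 * ρ 7
      + w P ^ (P.CS + 1 - k) * Vg ^ 3 * ρ 8)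
/-- (re-cut copy of `Stage1Cells.openSquare`, remainder reads as slots `ρ`) Cell 12: `Bound[OpenSquare,m,s]/(2dz)^k`, AS CODED (product form, and the literal `10`s of HOME/DIVERGENCE.md D26).
[cite: FitznerVanDerHofstad2017, notebook Percolation.nb cell 12 (transcript l.419–429)] -/
def openSquare (m k : ℕ) : T :=
  min (w P ^ (m - k) * Vg ^ 4 * tab (.K 4 m .v1))
    (max (sumR m P.CS fun j => C (j + 1 - m) * C (j + 2 - m) * C (j + 3 - m) * z ^ j * tab (.baw j .v2) /ₙ 6)
         (sumR m P.CS fun j => C (j + 1 - m) * C (j + 2 - m) * C (j + 3 - m) * z ^ j * tab (.baw j .v1) /ₙ 6)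
        * C (10 + 1 - m) * C (10 + 2 - m) * C (10 + 3 - m) * w P ^ (P.CS + 1 - k) * Vg * ρ 6 /ₙ 6
      + C (10 - m) * C (10 - 1 - m) * w P ^ (P.CS + 1 - k) * Vg ^ 2 * ρ 7 /ₙ 2
      + C (10 - m) * w P ^ (P.CS + 1 - k) * Vg ^ 3 * ρ 8
      + w P ^ (P.CS + 1 - k) * Vg ^ 4 * ρ 9)
/-! ## Cells 13–15: weighted diagrams -/
/-- (re-cut copy of `Stage1Cells.Rec.wb2`, remainder reads as slots `ρ`) Cell 15 (coded line, over the record `WB₃`): `Bound[WeightedBubble,2,s]/(2dz)^k = WB3 + 8d z² Gtwoi4 + 4d(2d−2) z^4 + 8d(2d−2) z² Gik4`.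
[cite: FitznerVanDerHofstad2017, notebook Percolation.nb cell 15 (transcript l.482–503)] -/
def wb2 (k : ℕ) : T :=
  Rec.wb3 P k
    + (C (2 * P.d * 4) * zsh P 2 k * Gtwoi4 P ρ + C 2 * zsh P 4 k * C 2 * C P.d * C (2 * P.d - 2)
        + C (2 * 2) * zsh P 2 k * C 2 * C P.d * C (2 * P.d - 2) * Gik4 P)
/-- (re-cut copy of `Stage1Cells.Rec.wb1`, remainder reads as slots `ρ`) Cell 15 (coded line, over the record `WB₂`): `Bound[WeightedBubble,1,s]/(2dz)^k = WB2 + (2dz)^{1−k} G13`.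
[cite: FitznerVanDerHofstad2017, notebook Percolation.nb cell 15 (transcript l.482–503)] -/
def wb1 (k : ℕ) : T := wb2 P ρ k + w P ^ (1 - k) * G13 P ρ
/-- (re-cut copy of `Stage1Cells.Rec.wb0`, remainder reads as slots `ρ`) Cell 15 (coded line): `Bound[WeightedBubble,0,s] = Bound[WeightedBubble,1,s]`. [cite: FitznerVanDerHofstad2017, notebook Percolation.nb cell 15] -/
def wb0 : T := wb1 P ρ 0
/-! ## Cells 16–17: the vectors `P^S`, `P^E`, `P^ι` -/
/-- (re-cut copy of `Stage1Cells.PS`, remainder reads as slots `ρ`) Cell 16: `Bound[PS,a,s]` = `(1 + ½B₂, Loop₄ + B₃, T₄ + ½B₂)`. [cite: FitznerVanDerHofstad2017, notebook Percolation.nb cell 16 (transcript l.527–534)] -/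
def PS : Vec := ![1 + bubble P ρ 2 0 /ₙ 2, Loop4 P ρ + bubble P ρ 3 0, triangle P ρ 4 0 + bubble P ρ 2 0 /ₙ 2]
/-- (re-cut copy of `Stage1Cells.PE`, remainder reads as slots `ρ`) Cell 16: `Bound[PE,a,s]` = `(1 + ½B₂, B₃, T₄)`. [cite: FitznerVanDerHofstad2017, notebook Percolation.nb cell 16 (transcript l.527–534)] -/
def PE : Vec := ![1 + bubble P ρ 2 0 /ₙ 2, bubble P ρ 3 0, triangle P ρ 4 0]
/-- (re-cut copy of `Stage1Cells.PSNT`, remainder reads as slots `ρ`) Cell 29 (`Vector[PSNT,s]`; Input cell 28 is empty): `PSNT = PS − (1,0,0)` in reduced form (M6a). [cite: FitznerVanDerHofstad2017, notebook Percolation.nb cell 29 (transcript l.829–857)] -/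
def PSNT : Vec := ![bubble P ρ 2 0 /ₙ 2, Loop4 P ρ + bubble P ρ 3 0, triangle P ρ 4 0 + bubble P ρ 2 0 /ₙ 2]
/-- (re-cut copy of `Stage1Cells.PENT`, remainder reads as slots `ρ`) Cell 29 (`Vector[PENT,s]`; Input cell 28 is empty): `PENT = PE − (1,0,0)` in reduced form (M6a). [cite: FitznerVanDerHofstad2017, notebook Percolation.nb cell 29 (transcript l.829–857)] -/
def PENT : Vec := ![bubble P ρ 2 0 /ₙ 2, bubble P ρ 3 0, triangle P ρ 4 0]
/-- (re-cut copy of `Stage1Cells.Piota`, remainder reads as slots `ρ`) Cell 17: `Bound[Piota,a,s]`. [cite: FitznerVanDerHofstad2017, notebook Percolation.nb cell 17 (transcript l.543–547)] -/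
def Piota : Vec :=
  ![C 1 /ₙ (2 * P.d) + G13 P ρ * (1 + bubble P ρ 2 0 /ₙ 2),
    G13 P ρ * (1 + PS P ρ 1),
    G13 P ρ * PS P ρ 2 + G13 P ρ + bubble P ρ 4 1 + (G13 P ρ + bubble P ρ 3 1) * (C 1 /ₙ 2) * bubble P ρ 2 0]
/-! ## Cells 18–24: the matrices -/
/-- (re-cut copy of `Stage1Cells.A`, remainder reads as slots `ρ`) Cell 18: `Bound[A,a,b,s]` (and, by cell 29 AS CODED, also `Matrix[ANonRep]`: HOME/DIVERGENCE.md D16).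
[cite: FitznerVanDerHofstad2017, notebook Percolation.nb cells 18, 29 (transcript l.559–580, l.829–857)] -/
def A : Mat :=
  !![bubble P ρ 2 0 /ₙ 2, bubble P ρ 3 0, triangle P ρ 4 0;
     bubble P ρ 3 1, bubble P ρ 3 1, triangle P ρ 4 1;
     openBubble P ρ 1 0, openBubble P ρ 2 0, openTriangle P ρ 3 0]
/-- (re-cut copy of `Stage1Cells.Aiota`, remainder reads as slots `ρ`) Cell 19: `Bound[Aiota,a,b,s]`. [cite: FitznerVanDerHofstad2017, notebook Percolation.nb cell 19 (transcript l.592–612)] -/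
def Aiota : Mat :=
  !![bubble P ρ 3 0, bubble P ρ 3 0, triangle P ρ 4 0;
     bubble P ρ 3 1, bubble P ρ 3 1, triangle P ρ 3 1;
     openBubble P ρ 2 0, openBubble P ρ 2 0, openTriangle P ρ 3 0]
/-- (re-cut copy of `Stage1Cells.AiotaNR`, remainder reads as slots `ρ`) Cell 19: `Bound[AiotaNonRep,a,b,s]`. [cite: FitznerVanDerHofstad2017, notebook Percolation.nb cell 19 (transcript l.592–612)] -/
def AiotaNR : Mat :=
  !![bubble P ρ 3 0, w P ^ 4 * Vg * tab (.I 1 4 .v0) + w P ^ 4 * Vg ^ 2 * tab (.I 2 4 .v0), w P ^ 4 * Vg ^ 3 * tab (.I 3 4 .v0);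
     w P ^ 3 * Vg * tab (.I 1 4 .v0) + w P ^ 3 * Vg ^ 2 * tab (.I 2 4 .v0),
       w P ^ 3 * Vg * tab (.I 1 4 .v0) + w P ^ 3 * Vg ^ 2 * tab (.I 2 4 .v0), w P ^ 3 * Vg ^ 3 * tab (.I 3 4 .v0);
     w P ^ 2 * Vg ^ 2 * tab (.K 2 2 .v1), w P ^ 2 * Vg ^ 2 * tab (.K 2 2 .v1), w P ^ 3 * Vg ^ 3 * tab (.K 3 3 .v1)]
/-- (re-cut copy of `Stage1Cells.AiotabarNR`, remainder reads as slots `ρ`) Cell 20: `Bound[AiotabarNonRep,a,b,s]` (column 1 = column 1 of `AiotaNonRep` divided by `2dz`, device M2).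
[cite: FitznerVanDerHofstad2017, notebook Percolation.nb cell 20 (transcript l.624–640)] -/
def AiotabarNR : Mat :=
  !![bubble P ρ 3 0, w P ^ 3 * Vg * tab (.I 1 4 .v0) + w P ^ 3 * Vg ^ 2 * tab (.I 2 4 .v0), w P ^ 2 * Vg ^ 2 * tab (.K 2 2 .v1);
     w P ^ 3 * Vg * tab (.I 1 4 .v0) + w P ^ 3 * Vg ^ 2 * tab (.I 2 4 .v0),
       w P ^ 2 * Vg * tab (.I 1 4 .v0) + w P ^ 2 * Vg ^ 2 * tab (.I 2 4 .v0), w P * Vg ^ 2 * tab (.K 2 2 .v0);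
     w P ^ 2 * Vg ^ 2 * tab (.K 2 2 .v1), w P * Vg ^ 2 * tab (.K 2 2 .v1), w P * Vg ^ 2 * tab (.K 2 1 .v0)]
/-- (re-cut copy of `Stage1Cells.AiotaBar`, remainder reads as slots `ρ`) Cell 20: `Bound[AiotaBar,a,b,s]` (column 1 = column 1 of `Aiota` divided by `2dz`). [cite: FitznerVanDerHofstad2017, notebook Percolation.nb cell 20 (transcript l.624–640)] -/
def AiotaBar : Mat :=
  !![bubble P ρ 3 0, bubble P ρ 3 1, openBubble P ρ 2 0;
     bubble P ρ 3 1, bubble P ρ 3 2, w P * Vg ^ 2 * tab (.K 2 2 .v0);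
     openBubble P ρ 2 0, openBubble P ρ 2 1, w P * Vg ^ 2 * tab (.K 2 1 .v0)]
/-- (re-cut copy of `Stage1Cells.B2i`, remainder reads as slots `ρ`) Cell 21: `Bound[B2i,a,b,s]` (only column 2 is non-zero). [cite: FitznerVanDerHofstad2017, notebook Percolation.nb cell 21 (transcript l.649–657)] -/
def B2i : Mat :=
  !![0, 0, bubble P ρ 3 1 * triangle P ρ 4 0 + triangle P ρ 4 0 * openTriangle P ρ 3 0;
     0, 0, bubble P ρ 3 1 * triangle P ρ 4 1 + triangle P ρ 4 1 * openTriangle P ρ 3 0;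
     0, 0, bubble P ρ 3 1 * openTriangle P ρ 3 0 + openBubble P ρ 2 0 * openTriangle P ρ 4 0]
/-- (re-cut copy of `Stage1Cells.Bbar2i`, remainder reads as slots `ρ`) Cell 22: `Bound[Bbar2i,a,b,s]`. [cite: FitznerVanDerHofstad2017, notebook Percolation.nb cell 22 (transcript l.666–676)] -/
def Bbar2i : Mat :=
  !![0, 0, 0;
     bubble P ρ 2 0 /ₙ 2 * openTriangle P ρ 3 0, bubble P ρ 2 1 /ₙ 2 * openTriangle P ρ 3 0, bubble P ρ 2 0 /ₙ 2 * Gmax1 P ρ ^ 2;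
     bubble P ρ 2 0 /ₙ 2 * openTriangle P ρ 4 0 + bubble P ρ 3 1 * triangle P ρ 4 0 + triangle P ρ 4 0 * openTriangle P ρ 3 0,
       bubble P ρ 2 1 /ₙ 2 * openTriangle P ρ 4 0 + bubble P ρ 3 2 * triangle P ρ 4 0 + triangle P ρ 4 1 * openTriangle P ρ 3 0,
       bubble P ρ 2 0 /ₙ 2 * Gmax1 P ρ * openBubble P ρ 2 0 + openTriangle P ρ 3 0 * bubble P ρ 3 1
         + Gmax1 P ρ * openBubble P ρ 1 0 * triangle P ρ 4 0]
/-- (re-cut copy of `Stage1Cells.Rec.H1`, remainder reads as slots `ρ`) (cell of record: re-bound copy of `Stage1Cells.H1` over the `Rec` weighted bubbles) Cell 23: `Bound[H1,a,b,s] = Bound[H2,a,b,s]`. [cite: FitznerVanDerHofstad2017, notebook Percolation.nb cell 23 (transcript l.694–722)] -/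
def H1 : Mat :=
  !![wb2 P ρ 0, wb2 P ρ 1, wob P 0 0;
     wb2 P ρ 1, wb2 P ρ 2, wob P 1 1;
     wob P 0 0, wob P 1 1, wob P 0 0]
/-- (re-cut copy of `Stage1Cells.Rec.H2`, remainder reads as slots `ρ`) (cell of record: re-bound copy of `Stage1Cells.H2` over the `Rec` weighted bubbles) Cell 23: `Bound[H2,…] = Bound[H1,…]`. [cite: FitznerVanDerHofstad2017, notebook Percolation.nb cell 23] -/
abbrev H2 : Mat := H1 P ρ
/-- (re-cut copy of `Stage1Cells.Rec.H3`, remainder reads as slots `ρ`) (cell of record: re-bound copy of `Stage1Cells.H3` over the `Rec` weighted bubbles) Cell 23: `Bound[H3,a,b,s]`. [cite: FitznerVanDerHofstad2017, notebook Percolation.nb cell 23 (transcript l.694–722)] -/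
def H3 : Mat :=
  !![wb2 P ρ 0, wb2 P ρ 1, wob P 1 0;
     wb2 P ρ 1, Rec.wb3 P 2, wob P 2 1;
     wob P 1 0, wob P 2 1, wob P 1 0]
/-- (re-cut copy of `Stage1Cells.Rec.C3`, remainder reads as slots `ρ`) (cell of record: re-bound copy of `Stage1Cells.C3` over the `Rec` weighted bubbles) Cell 24: `Bound[C3,a,b,s]`. [cite: FitznerVanDerHofstad2017, notebook Percolation.nb cell 24 (transcript l.758–769)] -/
def C3 : Mat :=
  !![wol0 * openTriangle P ρ 3 0 * square P ρ 4 0 + wb1 P ρ 0 * openBubble P ρ 2 0 * triangle P ρ 3 0,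
       wol0 * openTriangle P ρ 3 1 * square P ρ 4 0 + wb1 P ρ 0 * openBubble P ρ 2 1 * triangle P ρ 3 0,
       wol0 * openTriangle P ρ 3 0 * openSquare P ρ 3 0 + wb1 P ρ 0 * w P * Vg ^ 2 * mx24 * triangle P ρ 3 0;
     wol0 * openTriangle P ρ 3 1 * square P ρ 4 0 + wb1 P ρ 0 * openBubble P ρ 2 0 * triangle P ρ 3 1,
       wol0 * openTriangle P ρ 3 1 * square P ρ 4 1 + wb1 P ρ 0 * openBubble P ρ 2 1 * triangle P ρ 3 1,
       wol0 * w P ^ 2 * Vg ^ 3 * tab (.I 3 2 .v0) * square P ρ 4 1 + wb1 P ρ 0 * w P * Vg ^ 2 * mx24 * triangle P ρ 4 1;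
     wol0 * openTriangle P ρ 3 0 * openSquare P ρ 3 0 + wb1 P ρ 0 * openBubble P ρ 2 0 * openTriangle P ρ 2 0,
       wol0 * w P ^ 2 * Vg ^ 3 * tab (.I 3 2 .v0) * square P ρ 4 1 + wb1 P ρ 0 * openBubble P ρ 2 1 * openTriangle P ρ 2 0,
       wol0 * w P ^ 2 * Vg ^ 3 * tab (.I 3 2 .v0) * openSquare P ρ 3 0 + wb1 P ρ 0 * w P * Vg ^ 2 * mx24 * openTriangle P ρ 2 0]
/-! ## Cells 26–31: `h^ι`, `h^{ιι}`, `B`, `B̄`, `C₁`, `C₂` -/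
/-- (re-cut copy of `Stage1Cells.Rec.hiP1`, remainder reads as slots `ρ`) (cell of record: re-bound copy of `Stage1Cells.hiP1` over the `Rec` weighted bubbles) Cell 26: `Bound[hi,part1,b,s]` = `(WB₂/(2d), WB₂/((2d)²z), WOB₁/(2d))`. [cite: FitznerVanDerHofstad2017, notebook Percolation.nb cell 26 (transcript l.787–800)] -/
def hiP1 : Vec := ![wb2 P ρ 0 /ₙ (2 * P.d), wb2 P ρ 1 /ₙ (2 * P.d), wob P 1 0 /ₙ (2 * P.d)]
/-- (re-cut copy of `Stage1Cells.Rec.hiP2`, remainder reads as slots `ρ`) (cell of record: re-bound copy of `Stage1Cells.hiP2` over the `Rec` weighted bubbles) Cell 26: `Bound[hi,part2,b,s]` (with `AiotaNonRep`, `AiotabarNonRep`), `Σ_a PS_a H2_{ab} − H2_{0b} = PSNT.H2_{·b}` (M6a). [cite: FitznerVanDerHofstad2017, notebook Percolation.nb cell 26 (transcript l.787–800)] -/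
def hiP2 (b : Fin 3) : T :=
  G13 P ρ * H2 P ρ 0 b + C 2 * G13 P ρ * vecMul (PSNT P ρ) (H2 P ρ) b
    + C 2 * G13 P ρ *
      (wb1 P ρ 0 /ₙ 2 * AiotaNR P ρ b 0 + wb1 P ρ 1 * AiotaNR P ρ b 1
        + min (min (wob P 0 0 * AiotaNR P ρ b 2) (wob P 1 0 * AiotaNR P ρ b 2 + wb1 P ρ 0 /ₙ 2 * AiotabarNR P ρ b 2))
            (wob P 1 0 * AiotaNR P ρ b 2 + wol0 /ₙ 2 * AiotaNR P ρ b 2))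
/-- (re-cut copy of `Stage1Cells.Rec.hiP3`, remainder reads as slots `ρ`) (cell of record: re-bound copy of `Stage1Cells.hiP3` over the `Rec` weighted bubbles) Cell 26: `Bound[hi,part3,b,s]`. [cite: FitznerVanDerHofstad2017, notebook Percolation.nb cell 26 (transcript l.787–800)] -/
def hiP3 (b : Fin 3) : T :=
  G13 P ρ * H2 P ρ 1 b + bubble P ρ 4 1 * H2 P ρ 2 b
    + C 2 * (G13 P ρ + bubble P ρ 3 1) *
      (bubble P ρ 2 0 /ₙ 2 * max (H2 P ρ 1 b) (H2 P ρ 2 b) + wb1 P ρ 0 /ₙ 2 * max (AiotabarNR P ρ 1 b) (AiotabarNR P ρ 2 b))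
/-- (re-cut copy of `Stage1Cells.Rec.hi`, remainder reads as slots `ρ`) (cell of record: re-bound copy of `Stage1Cells.hi` over the `Rec` weighted bubbles) Cell 26: `Bound[hi,b,s] = part1 + part2 + part3`. [cite: FitznerVanDerHofstad2017, notebook Percolation.nb cell 26 (transcript l.787–800)] -/
def hi : Vec := fun b => hiP1 P ρ b + hiP2 P ρ b + hiP3 P ρ b
/-- (re-cut copy of `Stage1Cells.Rec.hII`, remainder reads as slots `ρ`) (cell of record: re-bound copy of `Stage1Cells.hII` over the `Rec` weighted bubbles) Cell 27: `Bound[hII,b,s] = hi_b + 2 Σ_a (hi_a AiotaNonRep_{ab} + Σ_c Piota_a AiotaNonRep_{ac} H2_{cb})`.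
[cite: FitznerVanDerHofstad2017, notebook Percolation.nb cell 27 (transcript l.809–813)] -/
def hII : Vec := fun b =>
  hi P ρ b + C 2 * sumL [(0 : Fin 3), 1, 2] (fun a =>
    hi P ρ a * AiotaNR P ρ a b + sumL [(0 : Fin 3), 1, 2] (fun c => Piota P ρ a * AiotaNR P ρ a c * H2 P ρ c b))
/-- (re-cut copy of `Stage1Cells.Rec.hS`, remainder reads as slots `ρ`) (cell of record: re-bound copy of `Stage1Cells.hS` over the `Rec` weighted bubbles) Cell 29: `hS = (H1_{0,b})_b`. [cite: FitznerVanDerHofstad2017, notebook Percolation.nb cell 29] -/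
def hS : Vec := fun b => H1 P ρ 0 b
/-- (re-cut copy of `Stage1Cells.Rec.hE`, remainder reads as slots `ρ`) (cell of record: re-bound copy of `Stage1Cells.hE` over the `Rec` weighted bubbles) Cell 29: `hE = (H3_{0,b})_b`. [cite: FitznerVanDerHofstad2017, notebook Percolation.nb cell 29] -/
def hE : Vec := fun b => H3 P ρ 0 b
/-- (re-cut copy of `Stage1Cells.B`, remainder reads as slots `ρ`) Cell 30: `B = AiotaNonRep.A + Aiota PS₀ + B2i`. [cite: FitznerVanDerHofstad2017, notebook Percolation.nb cell 30 (transcript l.869–872)] -/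
def B : Mat := madd (madd (matMul (AiotaNR P ρ) (A P ρ)) (smul (PS P ρ 0) (Aiota P ρ))) (B2i P ρ)
/-- (re-cut copy of `Stage1Cells.Bbar`, remainder reads as slots `ρ`) Cell 30: `Bbar = Aiota.ANonRep + Aiota + Bbar2i` (`ANonRep = A` as coded, D16). [cite: FitznerVanDerHofstad2017, notebook Percolation.nb cell 30 (transcript l.869–872)] -/
def Bbar : Mat := madd (madd (matMul (Aiota P ρ) (A P ρ)) (Aiota P ρ)) (Bbar2i P ρ)
/-- (re-cut copy of `Stage1Cells.Rec.C1`, remainder reads as slots `ρ`) (cell of record: re-bound copy of `Stage1Cells.C1` over the `Rec` weighted bubbles) Cell 31: `C1 = (2 H2.A + 2 AiotaNonRep.H1 + H2).Aiota + H2.Bbar2i`. [cite: FitznerVanDerHofstad2017, notebook Percolation.nb cell 31 (transcript l.884–888)] -/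
def C1 : Mat :=
  madd (matMul (madd (madd (smul 2 (matMul (H2 P ρ) (A P ρ))) (smul 2 (matMul (AiotaNR P ρ) (H1 P ρ)))) (H2 P ρ)) (Aiota P ρ))
    (matMul (H2 P ρ) (Bbar2i P ρ))
/-- (re-cut copy of `Stage1Cells.Rec.C2`, remainder reads as slots `ρ`) (cell of record: re-bound copy of `Stage1Cells.C2` over the `Rec` weighted bubbles) Cell 31: `C2 = (2 H3.A + 2 AiotaNonRep.H1 + H3).Aiota + 2 C3 + H3.Bbar2i`. [cite: FitznerVanDerHofstad2017, notebook Percolation.nb cell 31 (transcript l.884–888)] -/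
def C2 : Mat :=
  madd (madd (matMul (madd (madd (smul 2 (matMul (H3 P ρ) (A P ρ))) (smul 2 (matMul (AiotaNR P ρ) (H1 P ρ)))) (H3 P ρ)) (Aiota P ρ))
    (smul 2 (C3 P ρ))) (matMul (H3 P ρ) (Bbar2i P ρ))
/-- (re-cut copy of `Stage1Cells.BminusAiota`, remainder reads as slots `ρ`) Cell 40: `B − Aiota` in reduced form (M6a): `AiotaNonRep.A + ½B₂ Aiota + B2i` (`PS₀ = 1 + ½B₂`). [cite: FitznerVanDerHofstad2017, notebook Percolation.nb cell 40 (transcript l.1109–1113)] -/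
def BminusAiota : Mat := madd (madd (matMul (AiotaNR P ρ) (A P ρ)) (smul (bubble P ρ 2 0 /ₙ 2) (Aiota P ρ))) (B2i P ρ)
/-- (re-cut copy of `Stage1Cells.Rec.C1minusH2Aiota`, remainder reads as slots `ρ`) (cell of record: re-bound copy of `Stage1Cells.C1minusH2Aiota` over the `Rec` weighted bubbles) Cell 40: `C1 − H2.Aiota` in reduced form (M6a): `(2 H2.A + 2 AiotaNonRep.H1).Aiota + H2.Bbar2i`. [cite: FitznerVanDerHofstad2017, notebook Percolation.nb cell 40 (transcript l.1109–1113)] -/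
def C1minusH2Aiota : Mat :=
  madd (matMul (madd (smul 2 (matMul (H2 P ρ) (A P ρ))) (smul 2 (matMul (AiotaNR P ρ) (H1 P ρ)))) (Aiota P ρ))
    (matMul (H2 P ρ) (Bbar2i P ρ))
/-! ## Cells 33–35: `N = 0, 1` -/
/-- (re-cut copy of `Stage1Cells.Xi0`, remainder reads as slots `ρ`) Cell 33: `Bound[Xi,0,s] = ½B₂`. [cite: FitznerVanDerHofstad2017, notebook Percolation.nb cell 33 (transcript l.934–945)] -/
def Xi0 : T := bubble P ρ 2 0 /ₙ 2
/-- (re-cut copy of `Stage1Cells.Rec.Xi0D`, remainder reads as slots `ρ`) (cell of record: re-bound copy of `Stage1Cells.Xi0D` over the `Rec` weighted bubbles) Cell 33: `Bound[Xi,0,Delta,s] = ½WB₁`. [cite: FitznerVanDerHofstad2017, notebook Percolation.nb cell 33] -/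
def Xi0D : T := wb1 P ρ 0 /ₙ 2
/-- (re-cut copy of `Stage1Cells.XiR0`, remainder reads as slots `ρ`) Cell 33: `Bound[Xi,R,0,s] = ½B₄`. [cite: FitznerVanDerHofstad2017, notebook Percolation.nb cell 33] -/
def XiR0 : T := bubble P ρ 4 0 /ₙ 2
/-- (re-cut copy of `Stage1Cells.Rec.XiR0D`, remainder reads as slots `ρ`) (cell of record: re-bound copy of `Stage1Cells.XiR0D` over the `Rec` weighted bubbles) Cell 33: `Bound[Xi,R,0,Delta,s] = ½WB₂`. [cite: FitznerVanDerHofstad2017, notebook Percolation.nb cell 33] -/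
def XiR0D : T := wb2 P ρ 0 /ₙ 2
/-- (re-cut copy of `Stage1Cells.PsiRII0`, remainder reads as slots `ρ`) Cell 33: `Bound[Psi,RII,0,s] = ½ Min[1, mubOverMu(d−1)/d] B₄`.
[cite: FitznerVanDerHofstad2017, notebook Percolation.nb cell 33] -/
def PsiRII0 : T := capMub P * bubble P ρ 4 0 /ₙ 2
/-- (re-cut copy of `Stage1Cells.Rec.PsiRII0D`, remainder reads as slots `ρ`) (cell of record: re-bound copy of `Stage1Cells.PsiRII0D` over the `Rec` weighted bubbles) Cell 33: `Bound[Psi,RII,0,Delta,s] = ½ Min[1, mubOverMu(d−1)/d] WB₂`.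
[cite: FitznerVanDerHofstad2017, notebook Percolation.nb cell 33] -/
def PsiRII0D : T := capMub P * wb2 P ρ 0 /ₙ 2
/-- (re-cut copy of `Stage1Cells.PsiRI0`, remainder reads as slots `ρ`) Cell 33: `Bound[Psi,RI,0,s] = (2d−2) z G₁₃ + ½ Min[1, mubOverMu(d−1)/d] B₄`.
[cite: FitznerVanDerHofstad2017, notebook Percolation.nb cell 33] -/
def PsiRI0 : T := C (2 * P.d - 2) * z * G13 P ρ + capMub P * bubble P ρ 4 0 /ₙ 2
/-- (re-cut copy of `Stage1Cells.Rec.PsiRI0D`, remainder reads as slots `ρ`) (cell of record: re-bound copy of `Stage1Cells.PsiRI0D` over the `Rec` weighted bubbles) Cell 33: `Bound[Psi,RI,0,Delta,s] = mubOverMu/2 (B₂ + WB₁)`.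
[cite: FitznerVanDerHofstad2017, notebook Percolation.nb cell 33] -/
def PsiRI0D : T := mubOverMu /ₙ 2 * (bubble P ρ 2 0 + wb1 P ρ 0)
/-- (re-cut copy of `Stage1Cells.XiIota0`, remainder reads as slots `ρ`) Cell 34: `Bound[XiIota,0,s] = G₁₃ (1 + ½B₂)`. [cite: FitznerVanDerHofstad2017, notebook Percolation.nb cell 34 (transcript l.951–969)] -/
def XiIota0 : T := G13 P ρ * (1 + bubble P ρ 2 0 /ₙ 2)
/-- (re-cut copy of `Stage1Cells.Rec.XiIota0Dei`, remainder reads as slots `ρ`) (cell of record: re-bound copy of `Stage1Cells.XiIota0Dei` over the `Rec` weighted bubbles) Cell 34: `Bound[XiIota,0,Delta,ei,s] = ½ G₁₃ WB₁`.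
[cite: FitznerVanDerHofstad2017, notebook Percolation.nb cell 34] -/
def XiIota0Dei : T := G13 P ρ * wb1 P ρ 0 /ₙ 2
/-- (re-cut copy of `Stage1Cells.Rec.XiIota0D0`, remainder reads as slots `ρ`) (cell of record: re-bound copy of `Stage1Cells.XiIota0D0` over the `Rec` weighted bubbles) Cell 34: `Bound[XiIota,0,Delta,0,s] = G₁₃ ((1 + ½B₂) + ½WB₁)`.
[cite: FitznerVanDerHofstad2017, notebook Percolation.nb cell 34] -/
def XiIota0D0 : T := G13 P ρ * (1 + bubble P ρ 2 0 /ₙ 2 + wb1 P ρ 0 /ₙ 2)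
/-- (re-cut copy of `Stage1Cells.XiIotaAlphaI0`, remainder reads as slots `ρ`) Cell 34: `Bound[XiIota,alphaI,0,Atei,s] = G₁₃`.
[cite: FitznerVanDerHofstad2017, notebook Percolation.nb cell 34] -/
def XiIotaAlphaI0 : T := G13 P ρ
/-- (re-cut copy of `Stage1Cells.XiIotaAlphaISum`, remainder reads as slots `ρ`) Cell 34: `Bound[XiIota,alphaI,SumAroundei,s] = G₁₃² (2d−1) z`.
[cite: FitznerVanDerHofstad2017, notebook Percolation.nb cell 34] -/
def XiIotaAlphaISum : T := G13 P ρ ^ 2 * C (2 * P.d - 1) * z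
/-- (re-cut copy of `Stage1Cells.XiIotaAlphaIISum`, remainder reads as slots `ρ`) Cell 34: `Bound[XiIota,alphaII,SumAroundZero,s] = G₁₃`.
[cite: FitznerVanDerHofstad2017, notebook Percolation.nb cell 34] -/
def XiIotaAlphaIISum : T := G13 P ρ
/-- (re-cut copy of `Stage1Cells.XiIotaRI0`, remainder reads as slots `ρ`) Cell 34: `Bound[XiIota,RI,0,s] = ½ G₁₃ B₄`. [cite: FitznerVanDerHofstad2017, notebook Percolation.nb cell 34] -/
def XiIotaRI0 : T := G13 P ρ * bubble P ρ 4 0 /ₙ 2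
/-- (re-cut copy of `Stage1Cells.Rec.XiIotaRI0Dei`, remainder reads as slots `ρ`) (cell of record: re-bound copy of `Stage1Cells.XiIotaRI0Dei` over the `Rec` weighted bubbles) Cell 34: `Bound[XiIota,RI,0,Delta,ei,s] = ½ G₁₃ WB₂`.
[cite: FitznerVanDerHofstad2017, notebook Percolation.nb cell 34] -/
def XiIotaRI0Dei : T := G13 P ρ * wb2 P ρ 0 /ₙ 2
/-- (re-cut copy of `Stage1Cells.XiIotaRII0`, remainder reads as slots `ρ`) Cell 34: `Bound[XiIota,RII,0,s] = ½ G₁₃ B₂`. [cite: FitznerVanDerHofstad2017, notebook Percolation.nb cell 34] -/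
def XiIotaRII0 : T := G13 P ρ * bubble P ρ 2 0 /ₙ 2
/-- (re-cut copy of `Stage1Cells.Rec.XiIotaRII0D0`, remainder reads as slots `ρ`) (cell of record: re-bound copy of `Stage1Cells.XiIotaRII0D0` over the `Rec` weighted bubbles) Cell 34: `Bound[XiIota,RII,0,Delta,0,s] = G₁₃/2 (B₂ + WB₁)`.
[cite: FitznerVanDerHofstad2017, notebook Percolation.nb cell 34] -/
def XiIotaRII0D0 : T := G13 P ρ /ₙ 2 * (bubble P ρ 2 0 + wb1 P ρ 0)
/-- (re-cut copy of `Stage1Cells.PiAlpha0`, remainder reads as slots `ρ`) Cell 34: `Bound[Pi,alpha,0,s] = (2d−2) z G₁₃`.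
[cite: FitznerVanDerHofstad2017, notebook Percolation.nb cell 34] -/
def PiAlpha0 : T := C (2 * P.d - 2) * z * G13 P ρ
/-- (re-cut copy of `Stage1Cells.PiR0`, remainder reads as slots `ρ`) Cell 34: `Bound[Pi,R,0,s] = 2d² z G₁₃ B₂`. [cite: FitznerVanDerHofstad2017, notebook Percolation.nb cell 34] -/
def PiR0 : T := C (2 * P.d ^ 2) * z * G13 P ρ * bubble P ρ 2 0
/-- (re-cut copy of `Stage1Cells.Rec.PiR0D`, remainder reads as slots `ρ`) (cell of record: re-bound copy of `Stage1Cells.PiR0D` over the `Rec` weighted bubbles) Cell 34: `Bound[Pi,R,0,Delta,s] = 2d² z G₁₃ (B₂ + WB₁)`.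
[cite: FitznerVanDerHofstad2017, notebook Percolation.nb cell 34] -/
def PiR0D : T := C (2 * P.d ^ 2) * z * G13 P ρ * (bubble P ρ 2 0 + wb1 P ρ 0)
/-- (re-cut copy of `Stage1Cells.Xi1`, remainder reads as slots `ρ`) Cell 35: `Bound[Xi,1,s] = PS.AiotaBar.PE`. [cite: FitznerVanDerHofstad2017, notebook Percolation.nb cell 35 (transcript l.980–1004)] -/
def Xi1 : T := dot (vecMul (PS P ρ) (AiotaBar P ρ)) (PE P ρ)
/-- (re-cut copy of `Stage1Cells.Xi1red`, remainder reads as slots `ρ`) Cell 35: `PS.AiotaBar.PE − AiotaBar₀₀` in reduced form (M6a): `(AiotaBar.PENT)₀ + (PSNT.AiotaBar)₀ + PSNT.AiotaBar.PENT`.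
[cite: FitznerVanDerHofstad2017, notebook Percolation.nb cell 35] -/
def Xi1red : T :=
  mulVec (AiotaBar P ρ) (PENT P ρ) 0 + vecMul (PSNT P ρ) (AiotaBar P ρ) 0 + dot (vecMul (PSNT P ρ) (AiotaBar P ρ)) (PENT P ρ)
/-- (re-cut copy of `Stage1Cells.XiR1`, remainder reads as slots `ρ`) Cell 35: `Bound[Xi,R,1,s] = PS.AiotaBar.PE − AiotaBar₀₀ + B₄`.
[cite: FitznerVanDerHofstad2017, notebook Percolation.nb cell 35] -/
def XiR1 : T := Xi1red P ρ + bubble P ρ 4 0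
/-- (re-cut copy of `Stage1Cells.PsiRI1`, remainder reads as slots `ρ`) Cell 35: `Bound[Psi,RI,1,s] = ((2d−1)/(2d)) mubOverMu (PS.AiotaBar.PE − AiotaBar₀₀ + (2d−2) z G₁₃ + B₄)`.
[cite: FitznerVanDerHofstad2017, notebook Percolation.nb cell 35] -/
def PsiRI1 : T :=
  C (2 * P.d - 1) * mubOverMu * (Xi1red P ρ + C (2 * P.d - 2) * z * G13 P ρ + bubble P ρ 4 0) /ₙ (2 * P.d)
/-- (re-cut copy of `Stage1Cells.PsiRII1`, remainder reads as slots `ρ`) Cell 35: `Bound[Psi,RII,1,s] = ((2d−1)/(2d)) mubOverMu (PS.AiotaBar.PE − AiotaBar₀₀ + B₄)`.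
[cite: FitznerVanDerHofstad2017, notebook Percolation.nb cell 35] -/
def PsiRII1 : T := C (2 * P.d - 1) * mubOverMu * (Xi1red P ρ + bubble P ρ 4 0) /ₙ (2 * P.d)
/-- (re-cut copy of `Stage1Cells.Rec.betatmp`, remainder reads as slots `ρ`) (cell of record: re-bound copy of `Stage1Cells.betatmp` over the `Rec` weighted bubbles) Cell 35: `betatmp`. [cite: FitznerVanDerHofstad2017, notebook Percolation.nb cell 35 (transcript l.980–1004)] -/
def betatmp : T :=
  H3 P ρ 0 0 + C 2 * (bubble P ρ 2 0 /ₙ 2 * wb2 P ρ 0 + wb1 P ρ 0 /ₙ 2 * bubble P ρ 3 0) + bubble P ρ 2 0 /ₙ 2 * wob P 2 0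
    + C 4 * Rec.wb3 P 1 * bubble P ρ 3 0 + C 4 * wob P 2 1 * bubble P ρ 4 0 + C 4 * wob P 2 0 * triangle P ρ 4 0
    + C 4 * wob P 1 0 * triangle P ρ 5 0
    + C 3 * dot (vecMul (hS P ρ) (tr (Aiota P ρ))) (PENT P ρ) + C 3 * dot (vecMul (PSNT P ρ) (H3 P ρ)) (PENT P ρ)
    + C 3 * dot (vecMul (PSNT P ρ) (Aiota P ρ)) (hE P ρ)
/-- (re-cut copy of `Stage1Cells.Rec.Xi1D`, remainder reads as slots `ρ`) (cell of record: re-bound copy of `Stage1Cells.Xi1D` over the `Rec` weighted bubbles) Cell 35: `Bound[Xi,1,Delta,s] = betatmp`. [cite: FitznerVanDerHofstad2017, notebook Percolation.nb cell 35] -/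
def Xi1D : T := betatmp P ρ
/-- (re-cut copy of `Stage1Cells.Rec.XiR1D`, remainder reads as slots `ρ`) (cell of record: re-bound copy of `Stage1Cells.XiR1D` over the `Rec` weighted bubbles) Cell 35: `Bound[Xi,R,1,Delta,s] = betatmp − H2₀₀ + WB₂ = betatmp` (exact cancellation `H2₀₀ = WB₂`, M6a).
[cite: FitznerVanDerHofstad2017, notebook Percolation.nb cell 35] -/
def XiR1D : T := betatmp P ρ
/-- (re-cut copy of `Stage1Cells.Rec.PsiRI1D`, remainder reads as slots `ρ`) (cell of record: re-bound copy of `Stage1Cells.PsiRI1D` over the `Rec` weighted bubbles) Cell 35: `Bound[Psi,RI,1,Delta,s] = mubOverMu (betatmp + Xi₁)`.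
[cite: FitznerVanDerHofstad2017, notebook Percolation.nb cell 35] -/
def PsiRI1D : T := mubOverMu * (betatmp P ρ + Xi1 P ρ)
/-- (re-cut copy of `Stage1Cells.Rec.PsiRII1D`, remainder reads as slots `ρ`) (cell of record: re-bound copy of `Stage1Cells.PsiRII1D` over the `Rec` weighted bubbles) Cell 35: `Bound[Psi,RII,1,Delta,s] = mubOverMu (betatmp − H2₀₀ + WB₂) = mubOverMu betatmp`.
[cite: FitznerVanDerHofstad2017, notebook Percolation.nb cell 35] -/
def PsiRII1D : T := mubOverMu * betatmp P ρ
/-- (re-cut copy of `Stage1Cells.XiIota1`, remainder reads as slots `ρ`) Cell 35: `Bound[XiIota,1,s] = Piota.AiotaBar.PE`.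
[cite: FitznerVanDerHofstad2017, notebook Percolation.nb cell 35] -/
def XiIota1 : T := dot (vecMul (Piota P ρ) (AiotaBar P ρ)) (PE P ρ)
/-- (re-cut copy of `Stage1Cells.Rec.XiIota1Dei`, remainder reads as slots `ρ`) (cell of record: re-bound copy of `Stage1Cells.XiIota1Dei` over the `Rec` weighted bubbles) Cell 35: `Bound[XiIota,1,Delta,ei,s] = hi₀ + 2 hi.PENT + 2 (Piota.Aiota).hE − hi₀ PENT₀ − (Piota.Aiota)₀ hE₀` in reduced
form (M6a): `hi₀ + hi₀ PENT₀ + 2 Σ_{b≥1} hi_b PENT_b + (Piota.Aiota)₀ hE₀ + 2 Σ_{b≥1} (Piota.Aiota)_b hE_b`.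
[cite: FitznerVanDerHofstad2017, notebook Percolation.nb cell 35] -/
def XiIota1Dei : T :=
  hi P ρ 0 + hi P ρ 0 * PENT P ρ 0 + C 2 * (hi P ρ 1 * PENT P ρ 1 + hi P ρ 2 * PENT P ρ 2)
    + vecMul (Piota P ρ) (Aiota P ρ) 0 * hE P ρ 0
    + C 2 * (vecMul (Piota P ρ) (Aiota P ρ) 1 * hE P ρ 1 + vecMul (Piota P ρ) (Aiota P ρ) 2 * hE P ρ 2)
/-- (re-cut copy of `Stage1Cells.Rec.XiIota1D0`, remainder reads as slots `ρ`) (cell of record: re-bound copy of `Stage1Cells.XiIota1D0` over the `Rec` weighted bubbles) Cell 35: `Bound[XiIota,1,Delta,0,s] = 2 XiIota₁Δei + 2 XiIota₁`.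
[cite: FitznerVanDerHofstad2017, notebook Percolation.nb cell 35] -/
def XiIota1D0 : T := C 2 * XiIota1Dei P ρ + C 2 * XiIota1 P ρ
/-! ## Cells 36–37: the increasing pieces (the decreasing LOWER bounds are assembled in `Stage1Frame.lean`) -/
/-- (re-cut copy of `Stage1Cells.theta2`, remainder reads as slots `ρ`) `theta2 = Max[Bound[G,ik,2,s], Bound[G,twoi,2,s]]` (cell 36). [cite: FitznerVanDerHofstad2017, notebook Percolation.nb cell 36 (transcript l.1013–1026)] -/
def theta2 : T := max (Gik2 P) (Gtwoi2 P ρ)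
/-- (re-cut copy of `Stage1Cells.theta4`, remainder reads as slots `ρ`) `theta4 = Max[Bound[G,ik,4,s], Bound[G,twoi,4,s]]` (cell 36).
[cite: FitznerVanDerHofstad2017, notebook Percolation.nb cell 36] -/
def theta4 : T := max (Gik4 P) (Gtwoi4 P ρ)
/-- (re-cut copy of `Stage1Cells.piAlphaLowSub`, remainder reads as slots `ρ`) Cell 36, `Bound[Pi,alpha,lower,0,s]`: the subtracted increasing part
`(2d−2)² z⁴ G₁₃² + (2d−2) z⁴ (Gtwoi₂ + (4d−5) Gik₂ + (4d−4) z³ + 2d ϑ)`.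
[cite: FitznerVanDerHofstad2017, notebook Percolation.nb cell 36] -/
def piAlphaLowSub : T :=
  C ((2 * P.d - 2) ^ 2) * z ^ 4 * G13 P ρ ^ 2
    + C (2 * P.d - 2) * z ^ 4 * (Gtwoi2 P ρ + C (4 * P.d - 5) * Gik2 P + C (4 * P.d - 4) * z ^ 3 + C (2 * P.d) * vartheta P)
/-- (re-cut copy of `Stage1Cells.piAlphaLowBr`, remainder reads as slots `ρ`) Cell 36: the bracket argument `G₁₃ + Gik₂ + 3 Gmax₁` of `Bound[Pi,alpha,lower,0,s]`.
[cite: FitznerVanDerHofstad2017, notebook Percolation.nb cell 36] -/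
def piAlphaLowBr : T := G13 P ρ + Gik2 P + C 3 * Gmax1 P ρ
/-- (re-cut copy of `Stage1Cells.psiLowBr1`, remainder reads as slots `ρ`) Cell 36, `Bound[Psi,lower,0,s]`: bracket argument `G₁₃ + 2θ₂ + 2z`.
[cite: FitznerVanDerHofstad2017, notebook Percolation.nb cell 36] -/
def psiLowBr1 : T := G13 P ρ + C 2 * theta2 P ρ + C 2 * z
/-- (re-cut copy of `Stage1Cells.psiLowBr2`, remainder reads as slots `ρ`) Cell 36, `Bound[Psi,lower,0,s]`: bracket argument `2z² + G₁₃ + 2θ₂ + 2ϑ + (d/(d−1)) (2dz)^5 VarGamma2 K[1,6,{0,1}]`.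
[cite: FitznerVanDerHofstad2017, notebook Percolation.nb cell 36] -/
def psiLowBr2 : T :=
  C 2 * z ^ 2 + G13 P ρ + C 2 * theta2 P ρ + C 2 * vartheta P + C P.d * w P ^ 5 * Vg * tab (.K 1 6 .v01) /ₙ (P.d - 1)
/-- (re-cut copy of `Stage1Cells.pi1Br0`, remainder reads as slots `ρ`) Cell 36, `Bound[Pi,1,Lower,s]`: bracket argument `z + 3G₁₃ + θ₂ + θ₄` (first term).
[cite: FitznerVanDerHofstad2017, notebook Percolation.nb cell 36] -/
def pi1Br0 : T := z + C 3 * G13 P ρ + theta2 P ρ + theta4 P ρ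
/-- (re-cut copy of `Stage1Cells.pi1T2`, remainder reads as slots `ρ`) Cell 36, `Bound[Pi,1,Lower,s]`: `θ₄ + ϑ` (second term).
[cite: FitznerVanDerHofstad2017, notebook Percolation.nb cell 36] -/
def pi1T2 : T := theta4 P ρ + vartheta P
/-- (re-cut copy of `Stage1Cells.pi1Br4a`, remainder reads as slots `ρ`) bracket argument `z + z² + 2G₁₃ + 2θ₄ + ϑ` (cell 36, fourth term).
[cite: FitznerVanDerHofstad2017, notebook Percolation.nb cell 36] -/
def pi1Br4a : T := z + z ^ 2 + C 2 * G13 P ρ + C 2 * theta4 P ρ + vartheta P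
/-- (re-cut copy of `Stage1Cells.pi1Br3a`, remainder reads as slots `ρ`) bracket argument `z + 2z² + 2z³ + 2G₁₃ + 4θ₄ + 2ϑ` = `pi1Br4a + (z² + 2z³ + 2θ₄ + ϑ)` (cell 36, third term).
[cite: FitznerVanDerHofstad2017, notebook Percolation.nb cell 36] -/
def pi1Br3a : T := pi1Br4a P ρ + (z ^ 2 + C 2 * z ^ 3 + C 2 * theta4 P ρ + vartheta P)
/-- (re-cut copy of `Stage1Cells.pi1Br4b`, remainder reads as slots `ρ`) bracket argument `G₁₃ + θ₂` (cell 36, fourth term).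
[cite: FitznerVanDerHofstad2017, notebook Percolation.nb cell 36] -/
def pi1Br4b : T := G13 P ρ + theta2 P ρ
/-- (re-cut copy of `Stage1Cells.pi1Br3b`, remainder reads as slots `ρ`) bracket argument `G₁₃ + θ₂ + ϑ` = `pi1Br4b + ϑ` (cell 36, third term).
[cite: FitznerVanDerHofstad2017, notebook Percolation.nb cell 36] -/
def pi1Br3b : T := pi1Br4b P ρ + vartheta P
/-- (re-cut copy of `Stage1Cells.pi1Br5a`, remainder reads as slots `ρ`) bracket argument `z + 2z² + 2G₁₃ + 4θ₄ + 3ϑ + (2dz)⁴ VarGamma2 Ivalue[1,8,{0}]` = `pi1Br4a + (…)` (cell 36, fifth term).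
[cite: FitznerVanDerHofstad2017, notebook Percolation.nb cell 36] -/
def pi1Br5a : T := pi1Br4a P ρ + (z ^ 2 + C 2 * theta4 P ρ + C 2 * vartheta P + w P ^ 4 * Vg * tab (.I 1 8 .v0))
/-- (re-cut copy of `Stage1Cells.pi1Br5b`, remainder reads as slots `ρ`) bracket argument `2G₁₃ + θ₂ + ϑ` = `pi1Br3b + G₁₃` (cell 36, fifth term).
[cite: FitznerVanDerHofstad2017, notebook Percolation.nb cell 36] -/
def pi1Br5b : T := pi1Br3b P ρ + G13 P ρ
/-- (re-cut copy of `Stage1Cells.XiAlpha10`, remainder reads as slots `ρ`) Cell 37: `Bound[Xi,alpha,1-0,AtEi,s] = (2d−2) z⁴ (1 − (1−z³)^{2d−3}) + z² ((2d−2) Gik₄ + Gtwoi₄)` (`2d−3 = 2(d−2)+1`).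
[cite: FitznerVanDerHofstad2017, notebook Percolation.nb cell 37 (transcript l.1035–1055)] -/
def XiAlpha10 : T := C (2 * P.d - 2) * z ^ 4 * oddComp (z ^ 3) (P.d - 2) + z ^ 2 * (C (2 * P.d - 2) * Gik4 P + Gtwoi4 P ρ)
/-- (re-cut copy of `Stage1Cells.XiAlpha01`, remainder reads as slots `ρ`) Cell 37: `Bound[Xi,alpha,0-1,AtEi,s] = z G₁₅ + (2d−2) z⁵ + 4(d−1) z⁴ (G₁₃ + Gik₄)`.
[cite: FitznerVanDerHofstad2017, notebook Percolation.nb cell 37] -/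
def XiAlpha01 : T := z * G1 P ρ 5 + C (2 * P.d - 2) * z ^ 5 + C (4 * (P.d - 1)) * z ^ 4 * (G13 P ρ + Gik4 P)
/-- (re-cut copy of `Stage1Cells.PsiAlphaI10`, remainder reads as slots `ρ`) Cell 37: `Bound[Psi,alphaI,1-0,AroundEi,s]`. [cite: FitznerVanDerHofstad2017, notebook Percolation.nb cell 37] -/
def PsiAlphaI10 : T :=
  mubOverMu * z ^ 2 * (C (2 * P.d - 2) * z ^ 2 + C (4 * (P.d - 1)) * Gik4 P + Gtwoi2 P ρ)
    + C (2 * P.d - 2) * mubOverMu * z ^ 4 * (G13 P ρ + Gik2 P + Gtwoi2 P ρ + C P.d * w P ^ 5 * Vg * tab (.K 1 6 .v01) /ₙ (P.d - 1))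
/-- (re-cut copy of `Stage1Cells.PsiAlphaI01main`, remainder reads as slots `ρ`) Cell 37, `Bound[Psi,alphaI,0-1,AroundEi,s]`: the increasing first part `mubOverMu z² ((2d−2)z² + 4(d−1)Gik₄ + Gtwoi₂ + (4d−3)G₁₃²)`.
[cite: FitznerVanDerHofstad2017, notebook Percolation.nb cell 37] -/
def PsiAlphaI01main : T :=
  mubOverMu * z ^ 2 * (C (2 * P.d - 2) * z ^ 2 + C (4 * (P.d - 1)) * Gik4 P + Gtwoi2 P ρ + C (4 * P.d - 3) * G13 P ρ ^ 2)
/-- (re-cut copy of `Stage1Cells.PsiAlphaI01brA`, remainder reads as slots `ρ`) … and the two bracket arguments `2G₁₃[s] + Gik₂[s]`, `G₁₃[o] + θ₂[s]` of `1 − 2(1 − ·)(1 − ·)`. [folklore] -/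
def PsiAlphaI01brA : T := C 2 * G13 P ρ + Gik2 P
/-- (re-cut copy of `Stage1Cells.PsiAlphaI01brB`, remainder reads as slots `ρ`) … the second bracket argument `G₁₃[o] + θ₂[s]` of `Bound[Psi,alphaI,0-1,AroundEi,s]`. [cite: FitznerVanDerHofstad2017, notebook Percolation.nb cell 37 (transcript l.1035–1055)] -/
def PsiAlphaI01brB : T := atom (.G13at .o) + theta2 P ρ
/-- (re-cut copy of `Stage1Cells.PsiAlphaII10`, remainder reads as slots `ρ`) Cell 37: `Bound[Psi,alphaII,1-0,AroundZero,s]`.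
[cite: FitznerVanDerHofstad2017, notebook Percolation.nb cell 37] -/
def PsiAlphaII10 : T :=
  C ((2 * P.d - 1) * (2 * P.d - 2)) * mubOverMu * z ^ 4 * oddComp (z ^ 3) (P.d - 2)
    + C (2 * P.d - 1) * mubOverMu * z ^ 2 * (C (2 * P.d - 2) * Gik4 P + Gtwoi4 P ρ)
    + C ((2 * P.d - 2) ^ 2) * z ^ 4 * G13 P ρ ^ 2
    + C (2 * P.d - 2) * z ^ 4 * (Gtwoi4 P ρ + C (4 * P.d - 5) * Gik2 P + C (4 * P.d - 4) * z ^ 3 + C (2 * P.d) * vartheta P)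
/-- (re-cut copy of `Stage1Cells.PsiAlphaII01main`, remainder reads as slots `ρ`) Cell 37, `Bound[Psi,alphaII,0-1,AroundZero,s]`: first part `(2d−1) z G₁₅`, coefficient `(2d−1)(2d−2) z⁴ mubOverMu`, and
the bracket arguments `z + 2G₁₃[o] + 2θ₄`, `G₁₃[o] + θ₂ + ϑ` of `1 − (1 − ·)(1 − ·)`.
[cite: FitznerVanDerHofstad2017, notebook Percolation.nb cell 37] -/
def PsiAlphaII01main : T := C (2 * P.d - 1) * z * G1 P ρ 5
/-- (re-cut copy of `Stage1Cells.PsiAlphaII01brA`, remainder reads as slots `ρ`) … its first bracket argument `z + 2G₁₃[o] + 2θ₄`. [cite: FitznerVanDerHofstad2017, notebook Percolation.nb cell 37 (transcript l.1035–1055)] -/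
def PsiAlphaII01brA : T := z + C 2 * atom (.G13at .o) + C 2 * theta4 P ρ
/-- (re-cut copy of `Stage1Cells.PsiAlphaII01brB`, remainder reads as slots `ρ`) … its second bracket argument `G₁₃[o] + θ₂ + ϑ`. [cite: FitznerVanDerHofstad2017, notebook Percolation.nb cell 37 (transcript l.1035–1055)] -/
def PsiAlphaII01brB : T := PsiAlphaI01brB P ρ + vartheta P
/-! ## Cells 38–40: `N = 2, 3` (the `EvenTail`/`OddTail` cells 41–42 are replaced by these first terms, `T″₀`) -/
/-- (re-cut copy of `Stage1Cells.Xi2`, remainder reads as slots `ρ`) Cell 38: `Bound[Xi,2,s] = PS.B.AiotaBar.PE`. [cite: FitznerVanDerHofstad2017, notebook Percolation.nb cell 38 (transcript l.1067–1084)] -/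
def Xi2 : T := dot (vecMul (vecMul (PS P ρ) (B P ρ)) (AiotaBar P ρ)) (PE P ρ)
/-- (re-cut copy of `Stage1Cells.XiIota2`, remainder reads as slots `ρ`) Cell 38: `Bound[XiIota,2,s] = Piota.B.AiotaBar.PE`.
[cite: FitznerVanDerHofstad2017, notebook Percolation.nb cell 38] -/
def XiIota2 : T := dot (vecMul (vecMul (Piota P ρ) (B P ρ)) (AiotaBar P ρ)) (PE P ρ)
/-- (re-cut copy of `Stage1Cells.Xi3`, remainder reads as slots `ρ`) Cell 38: `Bound[Xi,3,s] = PS.B.B.AiotaBar.PE`.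
[cite: FitznerVanDerHofstad2017, notebook Percolation.nb cell 38] -/
def Xi3 : T := dot (vecMul (vecMul (vecMul (PS P ρ) (B P ρ)) (B P ρ)) (AiotaBar P ρ)) (PE P ρ)
/-- (re-cut copy of `Stage1Cells.XiIota3`, remainder reads as slots `ρ`) Cell 38: `Bound[XiIota,3,s] = Piota.B.B.AiotaBar.PE`.
[cite: FitznerVanDerHofstad2017, notebook Percolation.nb cell 38] -/
def XiIota3 : T := dot (vecMul (vecMul (vecMul (Piota P ρ) (B P ρ)) (B P ρ)) (AiotaBar P ρ)) (PE P ρ)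
/-- (re-cut copy of `Stage1Cells.Rec.C1BbarBC2`, remainder reads as slots `ρ`) (cell of record: re-bound copy of `Stage1Cells.C1BbarBC2` over the `Rec` weighted bubbles) `C1.Bbar + B.C2` (cells 38, 40). [cite: FitznerVanDerHofstad2017, notebook Percolation.nb cell 38] -/
def C1BbarBC2 : Mat := madd (matMul (C1 P ρ) (Bbar P ρ)) (matMul (B P ρ) (C2 P ρ))
/-- (re-cut copy of `Stage1Cells.Rec.H2PENTAhE`, remainder reads as slots `ρ`) (cell of record: re-bound copy of `Stage1Cells.H2PENTAhE` over the `Rec` weighted bubbles) `H2.PENT + Aiota.hE` (cells 38, 40). [cite: FitznerVanDerHofstad2017, notebook Percolation.nb cell 38] -/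
def H2PENTAhE : Vec := vadd (mulVec (H2 P ρ) (PENT P ρ)) (mulVec (Aiota P ρ) (hE P ρ))
/-- (re-cut copy of `Stage1Cells.Rec.hSAt`, remainder reads as slots `ρ`) (cell of record: re-bound copy of `Stage1Cells.hSAt` over the `Rec` weighted bubbles) `hS.Transpose[Aiota]` (cells 38, 40). [cite: FitznerVanDerHofstad2017, notebook Percolation.nb cell 38] -/
def hSAt : Vec := vecMul (hS P ρ) (tr (Aiota P ρ))
/-- (re-cut copy of `Stage1Cells.Rec.Xi3D`, remainder reads as slots `ρ`) (cell of record: re-bound copy of `Stage1Cells.Xi3D` over the `Rec` weighted bubbles) Cell 38: `Bound[Xi,3,Delta,s]`. [cite: FitznerVanDerHofstad2017, notebook Percolation.nb cell 38] -/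
def Xi3D : T :=
  C 3 * (dot (vecMul (vecMul (vecMul e0 (B P ρ)) (B P ρ)) (H3 P ρ)) e0
          + dot (vecMul e0 (madd (matMul (B P ρ) (C1 P ρ)) (matMul (C2 P ρ) (Bbar P ρ)))) e0)
    + C 4 * (dot (vecMul (vecMul e0 (B P ρ)) (B P ρ)) (H2PENTAhE P ρ) + dot (vecMul e0 (C1BbarBC2 P ρ)) (PENT P ρ))
    + C 4 * (dot (vecMul (vecMul (hSAt P ρ) (Bbar P ρ)) (Bbar P ρ)) e0 + dot (vecMul (vecMul (PSNT P ρ) (B P ρ)) (B P ρ)) (mulVec (H2 P ρ) e0)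
          + dot (vecMul (PSNT P ρ) (C1BbarBC2 P ρ)) e0)
    + C 5 * (dot (vecMul (vecMul (hSAt P ρ) (Bbar P ρ)) (Bbar P ρ)) (PENT P ρ)
          + dot (vecMul (vecMul (PSNT P ρ) (B P ρ)) (B P ρ)) (H2PENTAhE P ρ) + dot (vecMul (PSNT P ρ) (C1BbarBC2 P ρ)) (PENT P ρ))
/-- (re-cut copy of `Stage1Cells.Rec.XiIota2Dei`, remainder reads as slots `ρ`) (cell of record: re-bound copy of `Stage1Cells.XiIota2Dei` over the `Rec` weighted bubbles) Cell 38: `Bound[XiIota,2,Delta,ei,s]`. [cite: FitznerVanDerHofstad2017, notebook Percolation.nb cell 38] -/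
def XiIota2Dei : T :=
  C 2 * (dot (vecMul (hII P ρ) (Bbar P ρ)) e0 + dot (vecMul (vecMul (Piota P ρ) (B P ρ)) (H3 P ρ)) e0)
    + C 3 * (dot (vecMul (hII P ρ) (Bbar P ρ)) (PENT P ρ)
          + dot (vecMul (Piota P ρ) (B P ρ)) (vadd (mulVec (H3 P ρ) (PENT P ρ)) (mulVec (Aiota P ρ) (hE P ρ))))
/-- (re-cut copy of `Stage1Cells.Rec.XiIota3Dei`, remainder reads as slots `ρ`) (cell of record: re-bound copy of `Stage1Cells.XiIota3Dei` over the `Rec` weighted bubbles) Cell 38: `Bound[XiIota,3,Delta,ei,s]`. [cite: FitznerVanDerHofstad2017, notebook Percolation.nb cell 38] -/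
def XiIota3Dei : T :=
  C 3 * (dot (vecMul (vecMul (hII P ρ) (Bbar P ρ)) (Bbar P ρ)) e0 + dot (vecMul (vecMul (vecMul (Piota P ρ) (B P ρ)) (B P ρ)) (H2 P ρ)) e0)
    + C 3 * dot (vecMul (vecMul (Piota P ρ) (B P ρ)) (C2 P ρ)) e0
    + C 4 * (dot (vecMul (vecMul (hII P ρ) (Bbar P ρ)) (Bbar P ρ)) (PENT P ρ)
          + dot (vecMul (vecMul (Piota P ρ) (B P ρ)) (B P ρ)) (H2PENTAhE P ρ))
    + C 4 * dot (vecMul (vecMul (Piota P ρ) (B P ρ)) (C2 P ρ)) (PENT P ρ)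
/-- (re-cut copy of `Stage1Cells.Rec.XiIota2D0`, remainder reads as slots `ρ`) (cell of record: re-bound copy of `Stage1Cells.XiIota2D0` over the `Rec` weighted bubbles) Cell 38: `Bound[XiIota,2,Delta,0,s]` (NB `Transpose[Aiota].hE` in the last term, as coded).
[cite: FitznerVanDerHofstad2017, notebook Percolation.nb cell 38] -/
def XiIota2D0 : T :=
  C 3 * dot (vecMul (vecMul (Piota P ρ) (B P ρ)) (AiotaBar P ρ)) e0 + C 4 * dot (vecMul (vecMul (Piota P ρ) (B P ρ)) (AiotaBar P ρ)) (PENT P ρ)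
    + C 3 * (dot (vecMul (hII P ρ) (Bbar P ρ)) e0 + dot (vecMul (vecMul (Piota P ρ) (B P ρ)) (H3 P ρ)) e0)
    + C 4 * (dot (vecMul (hII P ρ) (Bbar P ρ)) (PENT P ρ)
          + dot (vecMul (Piota P ρ) (B P ρ)) (vadd (mulVec (H3 P ρ) (PENT P ρ)) (mulVec (tr (Aiota P ρ)) (hE P ρ))))
/-- (re-cut copy of `Stage1Cells.Rec.XiIota3D0`, remainder reads as slots `ρ`) (cell of record: re-bound copy of `Stage1Cells.XiIota3D0` over the `Rec` weighted bubbles) Cell 38: `Bound[XiIota,3,Delta,0,s]`. [cite: FitznerVanDerHofstad2017, notebook Percolation.nb cell 38] -/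
def XiIota3D0 : T :=
  C 4 * dot (vecMul (vecMul (vecMul (Piota P ρ) (B P ρ)) (B P ρ)) (AiotaBar P ρ)) e0
    + C 5 * dot (vecMul (vecMul (vecMul (Piota P ρ) (B P ρ)) (B P ρ)) (AiotaBar P ρ)) (PENT P ρ)
    + C 4 * (dot (vecMul (vecMul (hII P ρ) (Bbar P ρ)) (Bbar P ρ)) e0 + dot (vecMul (vecMul (vecMul (Piota P ρ) (B P ρ)) (B P ρ)) (H2 P ρ)) e0)
    + C 4 * dot (vecMul (vecMul (Piota P ρ) (B P ρ)) (C2 P ρ)) e0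
    + C 5 * (dot (vecMul (vecMul (hII P ρ) (Bbar P ρ)) (Bbar P ρ)) (PENT P ρ)
          + dot (vecMul (vecMul (Piota P ρ) (B P ρ)) (B P ρ)) (H2PENTAhE P ρ))
    + C 5 * dot (vecMul (vecMul (Piota P ρ) (B P ρ)) (C2 P ρ)) (PENT P ρ)
/-- (re-cut copy of `Stage1Cells.Rec.HdashA1`, remainder reads as slots `ρ`) (cell of record: re-bound copy of `Stage1Cells.HdashA1` over the `Rec` weighted bubbles) Cell 39: `Bound[Hdash,AtZero,1,s] = (WB₁ + WOB₁ B₂)/(1 − OpenBubble₁)` — the inverse is the derived atom `hdInv` (M6c).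
[cite: FitznerVanDerHofstad2017, notebook Percolation.nb cell 39 (transcript l.1098–1106)] -/
def HdashA1 : T := wb1 P ρ 0 * atom .hdInv + wob P 1 0 * bubble P ρ 2 0 * atom .hdInv
/-- (re-cut copy of `Stage1Cells.Rec.HdashA2`, remainder reads as slots `ρ`) (cell of record: re-bound copy of `Stage1Cells.HdashA2` over the `Rec` weighted bubbles) Cell 39: `Bound[Hdash,AtZero,2,s]/(2dz)^k = WB₂/(2dz)^k + Hdash_{AtZero,1} OpenBubble₂/(2dz)^k + B₂ WOB₂/(2dz)^k`.
[cite: FitznerVanDerHofstad2017, notebook Percolation.nb cell 39] -/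
def HdashA2 (k : ℕ) : T := wb2 P ρ k + HdashA1 P ρ * openBubble P ρ 2 k + bubble P ρ 2 0 * wob P 2 k
/-- (re-cut copy of `Stage1Cells.Rec.HdashN`, remainder reads as slots `ρ`) (cell of record: re-bound copy of `Stage1Cells.HdashN` over the `Rec` weighted bubbles) Cell 39: `Bound[Hdash,NotZero,l,s] = WOB_l + Hdash_{AtZero,1} OpenBubble_l + B₂ WOB_l`, `l = 1, 2`.
[cite: FitznerVanDerHofstad2017, notebook Percolation.nb cell 39] -/
def HdashN (l : ℕ) : T := wob P l 0 + HdashA1 P ρ * openBubble P ρ l 0 + bubble P ρ 2 0 * wob P l 0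
/-- (re-cut copy of `Stage1Cells.Rec.Xi2D`, remainder reads as slots `ρ`) (cell of record: re-bound copy of `Stage1Cells.Xi2D` over the `Rec` weighted bubbles) Cell 40: `Bound[Xi,2,Delta,s]` with `B − Aiota`, `C1 − H2.Aiota` in reduced form (M6a). [cite: FitznerVanDerHofstad2017, notebook Percolation.nb cell 40 (transcript l.1109–1113)] -/
def Xi2D : T :=
  C 2 * (dot (vecMul (vecMul e0 (BminusAiota P ρ)) (H3 P ρ)) e0 + dot (vecMul e0 (C1minusH2Aiota P ρ)) e0)
    + (bubble P ρ 3 0 * HdashN P ρ 1 + bubble P ρ 3 1 * HdashN P ρ 2 + C 2 * bubble P ρ 3 0 * wb2 P ρ 0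
        + C 2 * Rec.wb3 P 1 * bubble P ρ 4 0 + C 2 * HdashA2 P ρ 1 * bubble P ρ 4 0 + C 2 * wob P 2 0 * triangle P ρ 5 0
        + C 2 * HdashN P ρ 1 * triangle P ρ 5 0)
    + C 6 * (dot (vecMul (hSAt P ρ) (Bbar P ρ)) e0 + dot (vecMul (vecMul (PSNT P ρ) (B P ρ)) (H3 P ρ)) e0
          + dot (vecMul (PSNT P ρ) (C1 P ρ)) e0)
    + C 4 * (dot (vecMul (hSAt P ρ) (Bbar P ρ)) (PENT P ρ)
          + dot (vecMul (PSNT P ρ) (B P ρ)) (vadd (mulVec (H3 P ρ) (PENT P ρ)) (mulVec (Aiota P ρ) (hE P ρ)))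
          + dot (vecMul (PSNT P ρ) (C1 P ρ)) (PENT P ρ))
/-! ## Cell 43: the aggregates (with `EvenTail := Bound[·,2,·]`, `OddTail := Bound[·,3,·]`, variant `T″₀`) -/
/-- (re-cut copy of `Stage1Cells.XiEven`, remainder reads as slots `ρ`) Cell 43 (`T″₀`): `Bound[Xi,Even,s] = Xi₀ + Xi₂`. [cite: FitznerVanDerHofstad2017, notebook Percolation.nb cell 43 (transcript l.1182–1202)] -/
def XiEven : T := Xi0 P ρ + Xi2 P ρ
/-- (re-cut copy of `Stage1Cells.XiOdd`, remainder reads as slots `ρ`) Cell 43 (`T″₀`): `Bound[Xi,Odd,s] = Xi₁ + Xi₃`.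
[cite: FitznerVanDerHofstad2017, notebook Percolation.nb cell 43] -/
def XiOdd : T := Xi1 P ρ + Xi3 P ρ
/-- (re-cut copy of `Stage1Cells.XiAbs`, remainder reads as slots `ρ`) Cell 43: `Bound[Xi,Absolut,s] = Odd + Even`. [cite: FitznerVanDerHofstad2017, notebook Percolation.nb cell 43] -/
def XiAbs : T := XiOdd P ρ + XiEven P ρ
/-- (re-cut copy of `Stage1Cells.Rec.XiEvenD`, remainder reads as slots `ρ`) (cell of record: re-bound copy of `Stage1Cells.XiEvenD` over the `Rec` weighted bubbles) Cell 43 (`T″₀`): `Bound[Xi,Even,Delta,s] = Xi₀Δ + Xi₂Δ`.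
[cite: FitznerVanDerHofstad2017, notebook Percolation.nb cell 43] -/
def XiEvenD : T := Xi0D P ρ + Xi2D P ρ
/-- (re-cut copy of `Stage1Cells.Rec.XiOddD`, remainder reads as slots `ρ`) (cell of record: re-bound copy of `Stage1Cells.XiOddD` over the `Rec` weighted bubbles) Cell 43 (`T″₀`): `Bound[Xi,Odd,Delta,s] = Xi₁Δ + Xi₃Δ`.
[cite: FitznerVanDerHofstad2017, notebook Percolation.nb cell 43] -/
def XiOddD : T := Xi1D P ρ + Xi3D P ρ
/-- (re-cut copy of `Stage1Cells.Rec.XiAbsD`, remainder reads as slots `ρ`) (cell of record: re-bound copy of `Stage1Cells.XiAbsD` over the `Rec` weighted bubbles) Cell 43: `Bound[Xi,Absolut,Delta,s]`. [cite: FitznerVanDerHofstad2017, notebook Percolation.nb cell 43] -/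
def XiAbsD : T := XiOddD P ρ + XiEvenD P ρ
/-- (re-cut copy of `Stage1Cells.XiIotaEven`, remainder reads as slots `ρ`) Cell 43 (`T″₀`): `Bound[XiIota,Even,s] = XiIota₀ + XiIota₂`.
[cite: FitznerVanDerHofstad2017, notebook Percolation.nb cell 43] -/
def XiIotaEven : T := XiIota0 P ρ + XiIota2 P ρ
/-- (re-cut copy of `Stage1Cells.XiIotaOdd`, remainder reads as slots `ρ`) Cell 43 (`T″₀`): `Bound[XiIota,Odd,s] = XiIota₁ + XiIota₃`.
[cite: FitznerVanDerHofstad2017, notebook Percolation.nb cell 43] -/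
def XiIotaOdd : T := XiIota1 P ρ + XiIota3 P ρ
/-- (re-cut copy of `Stage1Cells.XiIotaAbs`, remainder reads as slots `ρ`) Cell 43: `Bound[XiIota,Absolut,s]`. [cite: FitznerVanDerHofstad2017, notebook Percolation.nb cell 43] -/
def XiIotaAbs : T := XiIotaOdd P ρ + XiIotaEven P ρ
/-- (re-cut copy of `Stage1Cells.Rec.XiIotaEvenDei`, remainder reads as slots `ρ`) (cell of record: re-bound copy of `Stage1Cells.XiIotaEvenDei` over the `Rec` weighted bubbles) Cell 43 (`T″₀`): `Bound[XiIota,Even,Delta,ei,s]`.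
[cite: FitznerVanDerHofstad2017, notebook Percolation.nb cell 43] -/
def XiIotaEvenDei : T := XiIota0Dei P ρ + XiIota2Dei P ρ
/-- (re-cut copy of `Stage1Cells.Rec.XiIotaOddDei`, remainder reads as slots `ρ`) (cell of record: re-bound copy of `Stage1Cells.XiIotaOddDei` over the `Rec` weighted bubbles) Cell 43 (`T″₀`): `Bound[XiIota,Odd,Delta,ei,s]`.
[cite: FitznerVanDerHofstad2017, notebook Percolation.nb cell 43] -/
def XiIotaOddDei : T := XiIota1Dei P ρ + XiIota3Dei P ρ
/-- (re-cut copy of `Stage1Cells.Rec.XiIotaAbsDei`, remainder reads as slots `ρ`) (cell of record: re-bound copy of `Stage1Cells.XiIotaAbsDei` over the `Rec` weighted bubbles) Cell 43: `Bound[XiIota,Absolut,Delta,ei,s]`. [cite: FitznerVanDerHofstad2017, notebook Percolation.nb cell 43] -/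
def XiIotaAbsDei : T := XiIotaOddDei P ρ + XiIotaEvenDei P ρ
/-- (re-cut copy of `Stage1Cells.Rec.XiIotaEvenD0`, remainder reads as slots `ρ`) (cell of record: re-bound copy of `Stage1Cells.XiIotaEvenD0` over the `Rec` weighted bubbles) Cell 43 (`T″₀`): `Bound[XiIota,Even,Delta,0,s]`.
[cite: FitznerVanDerHofstad2017, notebook Percolation.nb cell 43] -/
def XiIotaEvenD0 : T := XiIota0D0 P ρ + XiIota2D0 P ρ
/-- (re-cut copy of `Stage1Cells.Rec.XiIotaOddD0`, remainder reads as slots `ρ`) (cell of record: re-bound copy of `Stage1Cells.XiIotaOddD0` over the `Rec` weighted bubbles) Cell 43 (`T″₀`): `Bound[XiIota,Odd,Delta,0,s]`.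
[cite: FitznerVanDerHofstad2017, notebook Percolation.nb cell 43] -/
def XiIotaOddD0 : T := XiIota1D0 P ρ + XiIota3D0 P ρ
/-- (re-cut copy of `Stage1Cells.Rec.XiIotaAbsD0`, remainder reads as slots `ρ`) (cell of record: re-bound copy of `Stage1Cells.XiIotaAbsD0` over the `Rec` weighted bubbles) Cell 43: `Bound[XiIota,Absolut,Delta,0,s]`. [cite: FitznerVanDerHofstad2017, notebook Percolation.nb cell 43] -/
def XiIotaAbsD0 : T := XiIotaOddD0 P ρ + XiIotaEvenD0 P ρ

end Cells

end Rem

/-! ## Literal reproduction of the record recipe: the slots valued at the record's own table reads -/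

/-- The record's own reads at the ten slots (DIVERGENCE.md D55 col. 4): rows 1–3 `Ivalue[1,R′,{0}]`, rows 4–6
`Ivalue[n,R′,{0}]` (`n = 2,3,4`), rows 7–10 `K[n,CS+1,{1}]` (`n = 1..4`). [cite: FitznerVanDerHofstad2017, notebook Percolation.nb cells 5, 8, 11, 12] -/
def printSlots (P : Params) : Fin 10 → T :=
  ![tab (.I 1 P.R .v0), tab (.I 1 P.R .v0), tab (.I 1 P.R .v0), tab (.I 2 P.R .v0), tab (.I 3 P.R .v0), tab (.I 4 P.R .v0),
    tab (.K 1 (P.CS + 1) .v1), tab (.K 2 (P.CS + 1) .v1), tab (.K 3 (P.CS + 1) .v1), tab (.K 4 (P.CS + 1) .v1)]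

section Repro

variable (P : Params)

/-- literal reproduction (R228 (2)): the re-cut cell at the record reads IS the record cell. [folklore] -/
@[simp] theorem G1_print (m : ℕ) : Rem.G1 P (printSlots P) m = Stage1Cells.G1 P m := rfl
/-- literal reproduction (R228 (2)): the re-cut cell at the record reads IS the record cell. [folklore] -/
@[simp] theorem G01_print (n : ℕ) : Rem.G01 P (printSlots P) n = Stage1Cells.G01 P n := rfl
/-- literal reproduction (R228 (2)): the re-cut cell at the record reads IS the record cell. [folklore] -/
@[simp] theorem Gtwoi6_print : Rem.Gtwoi6 P (printSlots P) = Stage1Cells.Gtwoi6 P := rfl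
/-- literal reproduction (R228 (2)): the re-cut cell at the record reads IS the record cell. [folklore] -/
@[simp] theorem Gtwoi4_print : Rem.Gtwoi4 P (printSlots P) = Stage1Cells.Gtwoi4 P := rfl
/-- literal reproduction (R228 (2)): the re-cut cell at the record reads IS the record cell. [folklore] -/
@[simp] theorem Gtwoi2_print : Rem.Gtwoi2 P (printSlots P) = Stage1Cells.Gtwoi2 P := rfl
/-- literal reproduction (R228 (2)): the re-cut cell at the record reads IS the record cell. [folklore] -/
@[simp] theorem Gmax1_print : Rem.Gmax1 P (printSlots P) = Stage1Cells.Gmax1 P := rfl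
/-- literal reproduction (R228 (2)): the re-cut cell at the record reads IS the record cell. [folklore] -/
@[simp] theorem G13_print : Rem.G13 P (printSlots P) = Stage1Cells.G13 P := rfl
/-- literal reproduction (R228 (2)): the re-cut cell at the record reads IS the record cell. [folklore] -/
@[simp] theorem Loop4_print : Rem.Loop4 P (printSlots P) = Stage1Cells.Loop4 P := rfl
/-- literal reproduction (R228 (2)): the re-cut cell at the record reads IS the record cell. [folklore] -/
@[simp] theorem bubble_print (m : ℕ) (k : ℕ) : Rem.bubble P (printSlots P) m k = Stage1Cells.bubble P m k := rfl
/-- literal reproduction (R228 (2)): the re-cut cell at the record reads IS the record cell. [folklore] -/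
@[simp] theorem triangle_print (m : ℕ) (k : ℕ) : Rem.triangle P (printSlots P) m k = Stage1Cells.triangle P m k := rfl
/-- literal reproduction (R228 (2)): the re-cut cell at the record reads IS the record cell. [folklore] -/
@[simp] theorem square_print (m : ℕ) (k : ℕ) : Rem.square P (printSlots P) m k = Stage1Cells.square P m k := rfl
/-- literal reproduction (R228 (2)): the re-cut cell at the record reads IS the record cell. [folklore] -/
@[simp] theorem openBubble_print (m : ℕ) (k : ℕ) : Rem.openBubble P (printSlots P) m k = Stage1Cells.openBubble P m k := rfl
/-- literal reproduction (R228 (2)): the re-cut cell at the record reads IS the record cell. [folklore] -/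
@[simp] theorem openTriangle_print (m : ℕ) (k : ℕ) : Rem.openTriangle P (printSlots P) m k = Stage1Cells.openTriangle P m k := rfl
/-- literal reproduction (R228 (2)): the re-cut cell at the record reads IS the record cell. [folklore] -/
@[simp] theorem openSquare_print (m : ℕ) (k : ℕ) : Rem.openSquare P (printSlots P) m k = Stage1Cells.openSquare P m k := rfl
/-- literal reproduction (R228 (2)): the re-cut cell at the record reads IS the record cell. [folklore] -/
@[simp] theorem wb2_print (k : ℕ) : Rem.wb2 P (printSlots P) k = Stage1Cells.Rec.wb2 P k := rfl
/-- literal reproduction (R228 (2)): the re-cut cell at the record reads IS the record cell. [folklore] -/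
@[simp] theorem wb1_print (k : ℕ) : Rem.wb1 P (printSlots P) k = Stage1Cells.Rec.wb1 P k := rfl
/-- literal reproduction (R228 (2)): the re-cut cell at the record reads IS the record cell. [folklore] -/
@[simp] theorem wb0_print : Rem.wb0 P (printSlots P) = Stage1Cells.Rec.wb0 P := rfl
/-- literal reproduction (R228 (2)): the re-cut cell at the record reads IS the record cell. [folklore] -/
@[simp] theorem PS_print : Rem.PS P (printSlots P) = Stage1Cells.PS P := rfl
/-- literal reproduction (R228 (2)): the re-cut cell at the record reads IS the record cell. [folklore] -/
@[simp] theorem PE_print : Rem.PE P (printSlots P) = Stage1Cells.PE P := rfl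
/-- literal reproduction (R228 (2)): the re-cut cell at the record reads IS the record cell. [folklore] -/
@[simp] theorem PSNT_print : Rem.PSNT P (printSlots P) = Stage1Cells.PSNT P := rfl
/-- literal reproduction (R228 (2)): the re-cut cell at the record reads IS the record cell. [folklore] -/
@[simp] theorem PENT_print : Rem.PENT P (printSlots P) = Stage1Cells.PENT P := rfl
/-- literal reproduction (R228 (2)): the re-cut cell at the record reads IS the record cell. [folklore] -/
@[simp] theorem Piota_print : Rem.Piota P (printSlots P) = Stage1Cells.Piota P := rfl
/-- literal reproduction (R228 (2)): the re-cut cell at the record reads IS the record cell. [folklore] -/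
@[simp] theorem A_print : Rem.A P (printSlots P) = Stage1Cells.A P := rfl
/-- literal reproduction (R228 (2)): the re-cut cell at the record reads IS the record cell. [folklore] -/
@[simp] theorem Aiota_print : Rem.Aiota P (printSlots P) = Stage1Cells.Aiota P := rfl
/-- literal reproduction (R228 (2)): the re-cut cell at the record reads IS the record cell. [folklore] -/
@[simp] theorem AiotaNR_print : Rem.AiotaNR P (printSlots P) = Stage1Cells.AiotaNR P := rfl
/-- literal reproduction (R228 (2)): the re-cut cell at the record reads IS the record cell. [folklore] -/
@[simp] theorem AiotabarNR_print : Rem.AiotabarNR P (printSlots P) = Stage1Cells.AiotabarNR P := rfl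
/-- literal reproduction (R228 (2)): the re-cut cell at the record reads IS the record cell. [folklore] -/
@[simp] theorem AiotaBar_print : Rem.AiotaBar P (printSlots P) = Stage1Cells.AiotaBar P := rfl
/-- literal reproduction (R228 (2)): the re-cut cell at the record reads IS the record cell. [folklore] -/
@[simp] theorem B2i_print : Rem.B2i P (printSlots P) = Stage1Cells.B2i P := rfl
/-- literal reproduction (R228 (2)): the re-cut cell at the record reads IS the record cell. [folklore] -/
@[simp] theorem Bbar2i_print : Rem.Bbar2i P (printSlots P) = Stage1Cells.Bbar2i P := rfl
/-- literal reproduction (R228 (2)): the re-cut cell at the record reads IS the record cell. [folklore] -/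
@[simp] theorem H1_print : Rem.H1 P (printSlots P) = Stage1Cells.Rec.H1 P := rfl
/-- literal reproduction (R228 (2)): the re-cut cell at the record reads IS the record cell. [folklore] -/
@[simp] theorem H2_print : Rem.H2 P (printSlots P) = Stage1Cells.Rec.H2 P := rfl
/-- literal reproduction (R228 (2)): the re-cut cell at the record reads IS the record cell. [folklore] -/
@[simp] theorem H3_print : Rem.H3 P (printSlots P) = Stage1Cells.Rec.H3 P := rfl
/-- literal reproduction (R228 (2)): the re-cut cell at the record reads IS the record cell. [folklore] -/
@[simp] theorem C3_print : Rem.C3 P (printSlots P) = Stage1Cells.Rec.C3 P := rfl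
/-- literal reproduction (R228 (2)): the re-cut cell at the record reads IS the record cell. [folklore] -/
@[simp] theorem hiP1_print : Rem.hiP1 P (printSlots P) = Stage1Cells.Rec.hiP1 P := rfl
/-- literal reproduction (R228 (2)): the re-cut cell at the record reads IS the record cell. [folklore] -/
@[simp] theorem hiP2_print (b : Fin 3) : Rem.hiP2 P (printSlots P) b = Stage1Cells.Rec.hiP2 P b := rfl
/-- literal reproduction (R228 (2)): the re-cut cell at the record reads IS the record cell. [folklore] -/
@[simp] theorem hiP3_print (b : Fin 3) : Rem.hiP3 P (printSlots P) b = Stage1Cells.Rec.hiP3 P b := rfl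
/-- literal reproduction (R228 (2)): the re-cut cell at the record reads IS the record cell. [folklore] -/
@[simp] theorem hi_print : Rem.hi P (printSlots P) = Stage1Cells.Rec.hi P := rfl
/-- literal reproduction (R228 (2)): the re-cut cell at the record reads IS the record cell. [folklore] -/
@[simp] theorem hII_print : Rem.hII P (printSlots P) = Stage1Cells.Rec.hII P := rfl
/-- literal reproduction (R228 (2)): the re-cut cell at the record reads IS the record cell. [folklore] -/
@[simp] theorem hS_print : Rem.hS P (printSlots P) = Stage1Cells.Rec.hS P := rfl
/-- literal reproduction (R228 (2)): the re-cut cell at the record reads IS the record cell. [folklore] -/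
@[simp] theorem hE_print : Rem.hE P (printSlots P) = Stage1Cells.Rec.hE P := rfl
/-- literal reproduction (R228 (2)): the re-cut cell at the record reads IS the record cell. [folklore] -/
@[simp] theorem B_print : Rem.B P (printSlots P) = Stage1Cells.B P := rfl
/-- literal reproduction (R228 (2)): the re-cut cell at the record reads IS the record cell. [folklore] -/
@[simp] theorem Bbar_print : Rem.Bbar P (printSlots P) = Stage1Cells.Bbar P := rfl
/-- literal reproduction (R228 (2)): the re-cut cell at the record reads IS the record cell. [folklore] -/
@[simp] theorem C1_print : Rem.C1 P (printSlots P) = Stage1Cells.Rec.C1 P := rfl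
/-- literal reproduction (R228 (2)): the re-cut cell at the record reads IS the record cell. [folklore] -/
@[simp] theorem C2_print : Rem.C2 P (printSlots P) = Stage1Cells.Rec.C2 P := rfl
/-- literal reproduction (R228 (2)): the re-cut cell at the record reads IS the record cell. [folklore] -/
@[simp] theorem BminusAiota_print : Rem.BminusAiota P (printSlots P) = Stage1Cells.BminusAiota P := rfl
/-- literal reproduction (R228 (2)): the re-cut cell at the record reads IS the record cell. [folklore] -/
@[simp] theorem C1minusH2Aiota_print : Rem.C1minusH2Aiota P (printSlots P) = Stage1Cells.Rec.C1minusH2Aiota P := rfl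
/-- literal reproduction (R228 (2)): the re-cut cell at the record reads IS the record cell. [folklore] -/
@[simp] theorem Xi0_print : Rem.Xi0 P (printSlots P) = Stage1Cells.Xi0 P := rfl
/-- literal reproduction (R228 (2)): the re-cut cell at the record reads IS the record cell. [folklore] -/
@[simp] theorem Xi0D_print : Rem.Xi0D P (printSlots P) = Stage1Cells.Rec.Xi0D P := rfl
/-- literal reproduction (R228 (2)): the re-cut cell at the record reads IS the record cell. [folklore] -/
@[simp] theorem XiR0_print : Rem.XiR0 P (printSlots P) = Stage1Cells.XiR0 P := rfl
/-- literal reproduction (R228 (2)): the re-cut cell at the record reads IS the record cell. [folklore] -/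
@[simp] theorem XiR0D_print : Rem.XiR0D P (printSlots P) = Stage1Cells.Rec.XiR0D P := rfl
/-- literal reproduction (R228 (2)): the re-cut cell at the record reads IS the record cell. [folklore] -/
@[simp] theorem PsiRII0_print : Rem.PsiRII0 P (printSlots P) = Stage1Cells.PsiRII0 P := rfl
/-- literal reproduction (R228 (2)): the re-cut cell at the record reads IS the record cell. [folklore] -/
@[simp] theorem PsiRII0D_print : Rem.PsiRII0D P (printSlots P) = Stage1Cells.Rec.PsiRII0D P := rfl
/-- literal reproduction (R228 (2)): the re-cut cell at the record reads IS the record cell. [folklore] -/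
@[simp] theorem PsiRI0_print : Rem.PsiRI0 P (printSlots P) = Stage1Cells.PsiRI0 P := rfl
/-- literal reproduction (R228 (2)): the re-cut cell at the record reads IS the record cell. [folklore] -/
@[simp] theorem PsiRI0D_print : Rem.PsiRI0D P (printSlots P) = Stage1Cells.Rec.PsiRI0D P := rfl
/-- literal reproduction (R228 (2)): the re-cut cell at the record reads IS the record cell. [folklore] -/
@[simp] theorem XiIota0_print : Rem.XiIota0 P (printSlots P) = Stage1Cells.XiIota0 P := rfl
/-- literal reproduction (R228 (2)): the re-cut cell at the record reads IS the record cell. [folklore] -/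
@[simp] theorem XiIota0Dei_print : Rem.XiIota0Dei P (printSlots P) = Stage1Cells.Rec.XiIota0Dei P := rfl
/-- literal reproduction (R228 (2)): the re-cut cell at the record reads IS the record cell. [folklore] -/
@[simp] theorem XiIota0D0_print : Rem.XiIota0D0 P (printSlots P) = Stage1Cells.Rec.XiIota0D0 P := rfl
/-- literal reproduction (R228 (2)): the re-cut cell at the record reads IS the record cell. [folklore] -/
@[simp] theorem XiIotaAlphaI0_print : Rem.XiIotaAlphaI0 P (printSlots P) = Stage1Cells.XiIotaAlphaI0 P := rfl
/-- literal reproduction (R228 (2)): the re-cut cell at the record reads IS the record cell. [folklore] -/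
@[simp] theorem XiIotaAlphaISum_print : Rem.XiIotaAlphaISum P (printSlots P) = Stage1Cells.XiIotaAlphaISum P := rfl
/-- literal reproduction (R228 (2)): the re-cut cell at the record reads IS the record cell. [folklore] -/
@[simp] theorem XiIotaAlphaIISum_print : Rem.XiIotaAlphaIISum P (printSlots P) = Stage1Cells.XiIotaAlphaIISum P := rfl
/-- literal reproduction (R228 (2)): the re-cut cell at the record reads IS the record cell. [folklore] -/
@[simp] theorem XiIotaRI0_print : Rem.XiIotaRI0 P (printSlots P) = Stage1Cells.XiIotaRI0 P := rfl
/-- literal reproduction (R228 (2)): the re-cut cell at the record reads IS the record cell. [folklore] -/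
@[simp] theorem XiIotaRI0Dei_print : Rem.XiIotaRI0Dei P (printSlots P) = Stage1Cells.Rec.XiIotaRI0Dei P := rfl
/-- literal reproduction (R228 (2)): the re-cut cell at the record reads IS the record cell. [folklore] -/
@[simp] theorem XiIotaRII0_print : Rem.XiIotaRII0 P (printSlots P) = Stage1Cells.XiIotaRII0 P := rfl
/-- literal reproduction (R228 (2)): the re-cut cell at the record reads IS the record cell. [folklore] -/
@[simp] theorem XiIotaRII0D0_print : Rem.XiIotaRII0D0 P (printSlots P) = Stage1Cells.Rec.XiIotaRII0D0 P := rfl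
/-- literal reproduction (R228 (2)): the re-cut cell at the record reads IS the record cell. [folklore] -/
@[simp] theorem PiAlpha0_print : Rem.PiAlpha0 P (printSlots P) = Stage1Cells.PiAlpha0 P := rfl
/-- literal reproduction (R228 (2)): the re-cut cell at the record reads IS the record cell. [folklore] -/
@[simp] theorem PiR0_print : Rem.PiR0 P (printSlots P) = Stage1Cells.PiR0 P := rfl
/-- literal reproduction (R228 (2)): the re-cut cell at the record reads IS the record cell. [folklore] -/
@[simp] theorem PiR0D_print : Rem.PiR0D P (printSlots P) = Stage1Cells.Rec.PiR0D P := rfl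
/-- literal reproduction (R228 (2)): the re-cut cell at the record reads IS the record cell. [folklore] -/
@[simp] theorem Xi1_print : Rem.Xi1 P (printSlots P) = Stage1Cells.Xi1 P := rfl
/-- literal reproduction (R228 (2)): the re-cut cell at the record reads IS the record cell. [folklore] -/
@[simp] theorem Xi1red_print : Rem.Xi1red P (printSlots P) = Stage1Cells.Xi1red P := rfl
/-- literal reproduction (R228 (2)): the re-cut cell at the record reads IS the record cell. [folklore] -/
@[simp] theorem XiR1_print : Rem.XiR1 P (printSlots P) = Stage1Cells.XiR1 P := rfl
/-- literal reproduction (R228 (2)): the re-cut cell at the record reads IS the record cell. [folklore] -/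
@[simp] theorem PsiRI1_print : Rem.PsiRI1 P (printSlots P) = Stage1Cells.PsiRI1 P := rfl
/-- literal reproduction (R228 (2)): the re-cut cell at the record reads IS the record cell. [folklore] -/
@[simp] theorem PsiRII1_print : Rem.PsiRII1 P (printSlots P) = Stage1Cells.PsiRII1 P := rfl
/-- literal reproduction (R228 (2)): the re-cut cell at the record reads IS the record cell. [folklore] -/
@[simp] theorem betatmp_print : Rem.betatmp P (printSlots P) = Stage1Cells.Rec.betatmp P := rfl
/-- literal reproduction (R228 (2)): the re-cut cell at the record reads IS the record cell. [folklore] -/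
@[simp] theorem Xi1D_print : Rem.Xi1D P (printSlots P) = Stage1Cells.Rec.Xi1D P := rfl
/-- literal reproduction (R228 (2)): the re-cut cell at the record reads IS the record cell. [folklore] -/
@[simp] theorem XiR1D_print : Rem.XiR1D P (printSlots P) = Stage1Cells.Rec.XiR1D P := rfl
/-- literal reproduction (R228 (2)): the re-cut cell at the record reads IS the record cell. [folklore] -/
@[simp] theorem PsiRI1D_print : Rem.PsiRI1D P (printSlots P) = Stage1Cells.Rec.PsiRI1D P := rfl
/-- literal reproduction (R228 (2)): the re-cut cell at the record reads IS the record cell. [folklore] -/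
@[simp] theorem PsiRII1D_print : Rem.PsiRII1D P (printSlots P) = Stage1Cells.Rec.PsiRII1D P := rfl
/-- literal reproduction (R228 (2)): the re-cut cell at the record reads IS the record cell. [folklore] -/
@[simp] theorem XiIota1_print : Rem.XiIota1 P (printSlots P) = Stage1Cells.XiIota1 P := rfl
/-- literal reproduction (R228 (2)): the re-cut cell at the record reads IS the record cell. [folklore] -/
@[simp] theorem XiIota1Dei_print : Rem.XiIota1Dei P (printSlots P) = Stage1Cells.Rec.XiIota1Dei P := rfl
/-- literal reproduction (R228 (2)): the re-cut cell at the record reads IS the record cell. [folklore] -/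
@[simp] theorem XiIota1D0_print : Rem.XiIota1D0 P (printSlots P) = Stage1Cells.Rec.XiIota1D0 P := rfl
/-- literal reproduction (R228 (2)): the re-cut cell at the record reads IS the record cell. [folklore] -/
@[simp] theorem theta2_print : Rem.theta2 P (printSlots P) = Stage1Cells.theta2 P := rfl
/-- literal reproduction (R228 (2)): the re-cut cell at the record reads IS the record cell. [folklore] -/
@[simp] theorem theta4_print : Rem.theta4 P (printSlots P) = Stage1Cells.theta4 P := rfl
/-- literal reproduction (R228 (2)): the re-cut cell at the record reads IS the record cell. [folklore] -/
@[simp] theorem piAlphaLowSub_print : Rem.piAlphaLowSub P (printSlots P) = Stage1Cells.piAlphaLowSub P := rfl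
/-- literal reproduction (R228 (2)): the re-cut cell at the record reads IS the record cell. [folklore] -/
@[simp] theorem piAlphaLowBr_print : Rem.piAlphaLowBr P (printSlots P) = Stage1Cells.piAlphaLowBr P := rfl
/-- literal reproduction (R228 (2)): the re-cut cell at the record reads IS the record cell. [folklore] -/
@[simp] theorem psiLowBr1_print : Rem.psiLowBr1 P (printSlots P) = Stage1Cells.psiLowBr1 P := rfl
/-- literal reproduction (R228 (2)): the re-cut cell at the record reads IS the record cell. [folklore] -/
@[simp] theorem psiLowBr2_print : Rem.psiLowBr2 P (printSlots P) = Stage1Cells.psiLowBr2 P := rfl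
/-- literal reproduction (R228 (2)): the re-cut cell at the record reads IS the record cell. [folklore] -/
@[simp] theorem pi1Br0_print : Rem.pi1Br0 P (printSlots P) = Stage1Cells.pi1Br0 P := rfl
/-- literal reproduction (R228 (2)): the re-cut cell at the record reads IS the record cell. [folklore] -/
@[simp] theorem pi1T2_print : Rem.pi1T2 P (printSlots P) = Stage1Cells.pi1T2 P := rfl
/-- literal reproduction (R228 (2)): the re-cut cell at the record reads IS the record cell. [folklore] -/
@[simp] theorem pi1Br4a_print : Rem.pi1Br4a P (printSlots P) = Stage1Cells.pi1Br4a P := rfl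
/-- literal reproduction (R228 (2)): the re-cut cell at the record reads IS the record cell. [folklore] -/
@[simp] theorem pi1Br3a_print : Rem.pi1Br3a P (printSlots P) = Stage1Cells.pi1Br3a P := rfl
/-- literal reproduction (R228 (2)): the re-cut cell at the record reads IS the record cell. [folklore] -/
@[simp] theorem pi1Br4b_print : Rem.pi1Br4b P (printSlots P) = Stage1Cells.pi1Br4b P := rfl
/-- literal reproduction (R228 (2)): the re-cut cell at the record reads IS the record cell. [folklore] -/
@[simp] theorem pi1Br3b_print : Rem.pi1Br3b P (printSlots P) = Stage1Cells.pi1Br3b P := rfl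
/-- literal reproduction (R228 (2)): the re-cut cell at the record reads IS the record cell. [folklore] -/
@[simp] theorem pi1Br5a_print : Rem.pi1Br5a P (printSlots P) = Stage1Cells.pi1Br5a P := rfl
/-- literal reproduction (R228 (2)): the re-cut cell at the record reads IS the record cell. [folklore] -/
@[simp] theorem pi1Br5b_print : Rem.pi1Br5b P (printSlots P) = Stage1Cells.pi1Br5b P := rfl
/-- literal reproduction (R228 (2)): the re-cut cell at the record reads IS the record cell. [folklore] -/
@[simp] theorem XiAlpha10_print : Rem.XiAlpha10 P (printSlots P) = Stage1Cells.XiAlpha10 P := rfl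
/-- literal reproduction (R228 (2)): the re-cut cell at the record reads IS the record cell. [folklore] -/
@[simp] theorem XiAlpha01_print : Rem.XiAlpha01 P (printSlots P) = Stage1Cells.XiAlpha01 P := rfl
/-- literal reproduction (R228 (2)): the re-cut cell at the record reads IS the record cell. [folklore] -/
@[simp] theorem PsiAlphaI10_print : Rem.PsiAlphaI10 P (printSlots P) = Stage1Cells.PsiAlphaI10 P := rfl
/-- literal reproduction (R228 (2)): the re-cut cell at the record reads IS the record cell. [folklore] -/
@[simp] theorem PsiAlphaI01main_print : Rem.PsiAlphaI01main P (printSlots P) = Stage1Cells.PsiAlphaI01main P := rfl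
/-- literal reproduction (R228 (2)): the re-cut cell at the record reads IS the record cell. [folklore] -/
@[simp] theorem PsiAlphaI01brA_print : Rem.PsiAlphaI01brA P (printSlots P) = Stage1Cells.PsiAlphaI01brA P := rfl
/-- literal reproduction (R228 (2)): the re-cut cell at the record reads IS the record cell. [folklore] -/
@[simp] theorem PsiAlphaI01brB_print : Rem.PsiAlphaI01brB P (printSlots P) = Stage1Cells.PsiAlphaI01brB P := rfl
/-- literal reproduction (R228 (2)): the re-cut cell at the record reads IS the record cell. [folklore] -/
@[simp] theorem PsiAlphaII10_print : Rem.PsiAlphaII10 P (printSlots P) = Stage1Cells.PsiAlphaII10 P := rfl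
/-- literal reproduction (R228 (2)): the re-cut cell at the record reads IS the record cell. [folklore] -/
@[simp] theorem PsiAlphaII01main_print : Rem.PsiAlphaII01main P (printSlots P) = Stage1Cells.PsiAlphaII01main P := rfl
/-- literal reproduction (R228 (2)): the re-cut cell at the record reads IS the record cell. [folklore] -/
@[simp] theorem PsiAlphaII01brA_print : Rem.PsiAlphaII01brA P (printSlots P) = Stage1Cells.PsiAlphaII01brA P := rfl
/-- literal reproduction (R228 (2)): the re-cut cell at the record reads IS the record cell. [folklore] -/
@[simp] theorem PsiAlphaII01brB_print : Rem.PsiAlphaII01brB P (printSlots P) = Stage1Cells.PsiAlphaII01brB P := rfl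
/-- literal reproduction (R228 (2)): the re-cut cell at the record reads IS the record cell. [folklore] -/
@[simp] theorem Xi2_print : Rem.Xi2 P (printSlots P) = Stage1Cells.Xi2 P := rfl
/-- literal reproduction (R228 (2)): the re-cut cell at the record reads IS the record cell. [folklore] -/
@[simp] theorem XiIota2_print : Rem.XiIota2 P (printSlots P) = Stage1Cells.XiIota2 P := rfl
/-- literal reproduction (R228 (2)): the re-cut cell at the record reads IS the record cell. [folklore] -/
@[simp] theorem Xi3_print : Rem.Xi3 P (printSlots P) = Stage1Cells.Xi3 P := rfl
/-- literal reproduction (R228 (2)): the re-cut cell at the record reads IS the record cell. [folklore] -/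
@[simp] theorem XiIota3_print : Rem.XiIota3 P (printSlots P) = Stage1Cells.XiIota3 P := rfl
/-- literal reproduction (R228 (2)): the re-cut cell at the record reads IS the record cell. [folklore] -/
@[simp] theorem C1BbarBC2_print : Rem.C1BbarBC2 P (printSlots P) = Stage1Cells.Rec.C1BbarBC2 P := rfl
/-- literal reproduction (R228 (2)): the re-cut cell at the record reads IS the record cell. [folklore] -/
@[simp] theorem H2PENTAhE_print : Rem.H2PENTAhE P (printSlots P) = Stage1Cells.Rec.H2PENTAhE P := rfl
/-- literal reproduction (R228 (2)): the re-cut cell at the record reads IS the record cell. [folklore] -/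
@[simp] theorem hSAt_print : Rem.hSAt P (printSlots P) = Stage1Cells.Rec.hSAt P := rfl
/-- literal reproduction (R228 (2)): the re-cut cell at the record reads IS the record cell. [folklore] -/
@[simp] theorem Xi3D_print : Rem.Xi3D P (printSlots P) = Stage1Cells.Rec.Xi3D P := rfl
/-- literal reproduction (R228 (2)): the re-cut cell at the record reads IS the record cell. [folklore] -/
@[simp] theorem XiIota2Dei_print : Rem.XiIota2Dei P (printSlots P) = Stage1Cells.Rec.XiIota2Dei P := rfl
/-- literal reproduction (R228 (2)): the re-cut cell at the record reads IS the record cell. [folklore] -/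
@[simp] theorem XiIota3Dei_print : Rem.XiIota3Dei P (printSlots P) = Stage1Cells.Rec.XiIota3Dei P := rfl
/-- literal reproduction (R228 (2)): the re-cut cell at the record reads IS the record cell. [folklore] -/
@[simp] theorem XiIota2D0_print : Rem.XiIota2D0 P (printSlots P) = Stage1Cells.Rec.XiIota2D0 P := rfl
/-- literal reproduction (R228 (2)): the re-cut cell at the record reads IS the record cell. [folklore] -/
@[simp] theorem XiIota3D0_print : Rem.XiIota3D0 P (printSlots P) = Stage1Cells.Rec.XiIota3D0 P := rfl
/-- literal reproduction (R228 (2)): the re-cut cell at the record reads IS the record cell. [folklore] -/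
@[simp] theorem HdashA1_print : Rem.HdashA1 P (printSlots P) = Stage1Cells.Rec.HdashA1 P := rfl
/-- literal reproduction (R228 (2)): the re-cut cell at the record reads IS the record cell. [folklore] -/
@[simp] theorem HdashA2_print (k : ℕ) : Rem.HdashA2 P (printSlots P) k = Stage1Cells.Rec.HdashA2 P k := rfl
/-- literal reproduction (R228 (2)): the re-cut cell at the record reads IS the record cell. [folklore] -/
@[simp] theorem HdashN_print (l : ℕ) : Rem.HdashN P (printSlots P) l = Stage1Cells.Rec.HdashN P l := rfl
/-- literal reproduction (R228 (2)): the re-cut cell at the record reads IS the record cell. [folklore] -/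
@[simp] theorem Xi2D_print : Rem.Xi2D P (printSlots P) = Stage1Cells.Rec.Xi2D P := rfl
/-- literal reproduction (R228 (2)): the re-cut cell at the record reads IS the record cell. [folklore] -/
@[simp] theorem XiEven_print : Rem.XiEven P (printSlots P) = Stage1Cells.XiEven P := rfl
/-- literal reproduction (R228 (2)): the re-cut cell at the record reads IS the record cell. [folklore] -/
@[simp] theorem XiOdd_print : Rem.XiOdd P (printSlots P) = Stage1Cells.XiOdd P := rfl
/-- literal reproduction (R228 (2)): the re-cut cell at the record reads IS the record cell. [folklore] -/
@[simp] theorem XiAbs_print : Rem.XiAbs P (printSlots P) = Stage1Cells.XiAbs P := rfl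
/-- literal reproduction (R228 (2)): the re-cut cell at the record reads IS the record cell. [folklore] -/
@[simp] theorem XiEvenD_print : Rem.XiEvenD P (printSlots P) = Stage1Cells.Rec.XiEvenD P := rfl
/-- literal reproduction (R228 (2)): the re-cut cell at the record reads IS the record cell. [folklore] -/
@[simp] theorem XiOddD_print : Rem.XiOddD P (printSlots P) = Stage1Cells.Rec.XiOddD P := rfl
/-- literal reproduction (R228 (2)): the re-cut cell at the record reads IS the record cell. [folklore] -/
@[simp] theorem XiAbsD_print : Rem.XiAbsD P (printSlots P) = Stage1Cells.Rec.XiAbsD P := rfl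
/-- literal reproduction (R228 (2)): the re-cut cell at the record reads IS the record cell. [folklore] -/
@[simp] theorem XiIotaEven_print : Rem.XiIotaEven P (printSlots P) = Stage1Cells.XiIotaEven P := rfl
/-- literal reproduction (R228 (2)): the re-cut cell at the record reads IS the record cell. [folklore] -/
@[simp] theorem XiIotaOdd_print : Rem.XiIotaOdd P (printSlots P) = Stage1Cells.XiIotaOdd P := rfl
/-- literal reproduction (R228 (2)): the re-cut cell at the record reads IS the record cell. [folklore] -/
@[simp] theorem XiIotaAbs_print : Rem.XiIotaAbs P (printSlots P) = Stage1Cells.XiIotaAbs P := rfl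
/-- literal reproduction (R228 (2)): the re-cut cell at the record reads IS the record cell. [folklore] -/
@[simp] theorem XiIotaEvenDei_print : Rem.XiIotaEvenDei P (printSlots P) = Stage1Cells.Rec.XiIotaEvenDei P := rfl
/-- literal reproduction (R228 (2)): the re-cut cell at the record reads IS the record cell. [folklore] -/
@[simp] theorem XiIotaOddDei_print : Rem.XiIotaOddDei P (printSlots P) = Stage1Cells.Rec.XiIotaOddDei P := rfl
/-- literal reproduction (R228 (2)): the re-cut cell at the record reads IS the record cell. [folklore] -/
@[simp] theorem XiIotaAbsDei_print : Rem.XiIotaAbsDei P (printSlots P) = Stage1Cells.Rec.XiIotaAbsDei P := rfl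
/-- literal reproduction (R228 (2)): the re-cut cell at the record reads IS the record cell. [folklore] -/
@[simp] theorem XiIotaEvenD0_print : Rem.XiIotaEvenD0 P (printSlots P) = Stage1Cells.Rec.XiIotaEvenD0 P := rfl
/-- literal reproduction (R228 (2)): the re-cut cell at the record reads IS the record cell. [folklore] -/
@[simp] theorem XiIotaOddD0_print : Rem.XiIotaOddD0 P (printSlots P) = Stage1Cells.Rec.XiIotaOddD0 P := rfl
/-- literal reproduction (R228 (2)): the re-cut cell at the record reads IS the record cell. [folklore] -/
@[simp] theorem XiIotaAbsD0_print : Rem.XiIotaAbsD0 P (printSlots P) = Stage1Cells.Rec.XiIotaAbsD0 P := rfl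

end Repro

end Stage1Cells
end Literature.Probability.FitznerVanDerHofstad2017
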